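import Literature.NumberTheory.LFunctions.SuzukiSingleOperatorKernelProofs
import Literature.NumberTheory.LFunctions.DobnerNewman
import HarnessLib

/-!
# Suzuki's kernels `K_ζ^{ω,ν}`, `G_ζ^{ω,ν}`: proofs of [Su21] Prop. 4.1 (1) and of (4.9) for the spectral kernel

Companion ("de-factification") file of `SuzukiCanonicalSystem.lean`, which states M. Suzuki,
*Hamiltonians arising from L-functions in the Selberg class*, J. Funct. Anal. **281** (2021) 109116
= arXiv:1606.05726 [Suzuki2021Hamiltonians], Prop. 4.1, for `L = ζ`, as the named facts `Suzuki2021_prop41`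
and `Suzuki2021_prop41_fourier` about the SPECTRALLY defined kernels
`suzukiKernel ω ν x = Re (2π)⁻¹ ∫_{Im z = 1+ω} Θ(z) e^{−izx} dz` ((2.6)), `Θ = suzukiTheta ω ν =
(ξ(½−ω−iz)/ξ(½+ω−iz))^ν`, and `suzukiArchKernel` (the same for the `ξ_∞ = γ`-ratio `suzukiThetaArch`).

PROVED HERE (RH-free throughout), under Suzuki's condition (2.8) `νω > 1` (`d_ζ = 1`):

* §1 a uniform Stirling-type ratio bound `‖Γ(w)‖ ≤ e^{3a} ‖w‖^{−a} ‖Γ(w + a)‖` (`Re w ≥ ½`, `a ≥ 0`), from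
  `Γ(w+a) = Γ(w) exp ∫₀^a ψ(w+t) dt` and `Re ψ ≥ log ‖·‖ − 3` (`log_norm_sub_three_le_re_digamma`);
* §2 the symbol decay `‖Θ(u+iv)‖, ‖Θ_∞(u+iv)‖ ≤ C (1+|u|)^{−νω}` UNIFORMLY in `v ≥ v₀ > ½ + ω`
  (`ξ = γ·ζ`, §1 for the `γ`-ratio, `|ζ(s−ω)| ≤ Σ n^{-σ}`, `|1/ζ(s+ω)| = |Σ μ(n)n^{-s-ω}| ≤ Σ n^{-σ}`);
* §3 holomorphy/continuity, line independence (`v > ½ + ω`) and **Prop. 4.1 (1)**: `K_ζ^{ω,ν}` and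
  `G_ζ^{ω,ν}` vanish on `(−∞,0)`; continuity (Prop. 4.1 (4)) and growth (Prop. 4.1 (5), here
  `|K(x)| ≤ D_v e^{vx}` for every `v > ½ + ω`);
* §4 reality and **(4.9) for the spectral kernel**: for `Im z > ½ + ω`, `x ↦ K(x)e^{izx}` is integrable and
  `∫₀^∞ K(x) e^{izx} dx = Θ(z)` — the statement of the named fact `Suzuki2021_prop41_fourier` WITH the
  hypothesis `νω > 1` under which the spectral kernel (2.6) is the printed (series-defined) one; see the
  ERRATUM note at `suzuki2021_prop41_laplace`;
* §5 the ERRATUM made formal: at `ω = ν = 1` (`νω = 1`, (2.8) fails) `|Θ(u + 2i)| ≥ c/(1+|u|)` on the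
  definition line, so (2.6) diverges, `suzukiKernel 1 1 ≡ 0` (Bochner junk), and the hypothesis-free named
  fact is false: `Suzuki2021_prop41_fourier_false : ¬ Suzuki2021_prop41_fourier`.

NOT proved here: Prop. 4.1 (2), (3) (the series representation (4.8)), (6), and the `C^k` clause.

## References

* [Suzuki2021Hamiltonians] M. Suzuki, J. Funct. Anal. 281 (2021) 109116 = arXiv:1606.05726, §2 (2.6), (2.8),
  §4.1 (4.2), Prop. 4.1, eqs. (4.7)–(4.9).
* [Suzuki2020IntegralOperators] M. Suzuki, ASPM 84 (2020), §3 (Stirling in a sector; moving the line of integration).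
* [Titchmarsh1986] E. C. Titchmarsh, *The Theory of the Riemann Zeta-Function*, 2nd ed., §2.1, §2.12.
-/

noncomputable section

open Complex MeasureTheory Filter Topology Set
open scoped Real ComplexConjugate FourierTransform

namespace Literature.NumberTheory.LFunctions

open Literature.Analysis.SpecialFunctions Literature.Analysis.SpecialFunctions.Complex

/-! ## §1 A uniform bound for `Γ(w)/Γ(w+a)` in the right half-plane -/

/-- `Γ(w) = Γ(w₀)·exp(∫_{[w₀,w]} ψ)` for `w₀, w` in the open RIGHT half-plane (segment integral of the
logarithmic derivative; the right-half-plane twin of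
`Literature.Analysis.SpecialFunctions.Complex.Gamma_eq_mul_exp_integral_digamma`).
[cite: AndrewsAskeyRoy1999, Thm. 1.2.5] -/
theorem Gamma_eq_mul_exp_integral_digamma_of_re_pos {w₀ w : ℂ} (h₀ : 0 < w₀.re) (h₁ : 0 < w.re) :
    Gamma w = Gamma w₀ *
      Complex.exp (∫ τ in (0:ℝ)..1, digamma (w₀ + τ * (w - w₀)) * (w - w₀)) := by
  set d : ℂ := w - w₀ with hd
  set seg : ℝ → ℂ := fun τ ↦ w₀ + τ * d with hseg
  have hre : ∀ τ ∈ Icc (0:ℝ) 1, 0 < (seg τ).re := by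
    intro τ hτ
    simp only [hseg, hd, add_re, mul_re, ofReal_re, sub_re, ofReal_im, zero_mul, sub_zero]
    have h1 := mul_nonneg hτ.1 h₁.le
    have h2 := mul_nonneg (sub_nonneg.2 hτ.2) h₀.le
    rcases le_or_gt τ (1/2) with hτ2 | hτ2
    · nlinarith
    · nlinarith
  have hpole : ∀ τ ∈ Icc (0:ℝ) 1, ∀ m : ℕ, seg τ ≠ -m := fun τ hτ m h ↦ by
    have := congrArg Complex.re h
    simp only [neg_re, natCast_re] at this
    have hm : (0 : ℝ) ≤ m := Nat.cast_nonneg m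
    linarith [hre τ hτ]
  -- clamped integrand, continuous on all of `ℝ`
  set cl : ℝ → ℝ := fun σ ↦ max 0 (min σ 1) with hcl
  have hcl_mem : ∀ σ, cl σ ∈ Icc (0:ℝ) 1 := fun σ ↦
    ⟨le_max_left _ _, max_le zero_le_one (min_le_right _ _)⟩
  have hcl_id : ∀ σ ∈ Icc (0:ℝ) 1, cl σ = σ := fun σ hσ ↦ by
    simp only [hcl]; rw [min_eq_left hσ.2, max_eq_right hσ.1]
  have hcl_cont : Continuous cl := by fun_prop
  set f : ℝ → ℂ := fun σ ↦ digamma (seg (cl σ)) * d with hf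
  have hf_cont : Continuous f := by
    refine Continuous.mul ?_ continuous_const
    have hsegc : Continuous fun σ ↦ seg (cl σ) := by
      simp only [hseg]; fun_prop
    refine (differentiableOn_digamma.continuousOn).comp_continuous hsegc fun σ ↦ ?_
    exact hre _ (hcl_mem σ)
  set P : ℝ → ℂ := fun τ ↦ ∫ σ in (0:ℝ)..τ, f σ with hP
  have hP_deriv : ∀ τ, HasDerivAt P (f τ) τ := fun τ ↦
    intervalIntegral.integral_hasDerivAt_right (hf_cont.intervalIntegrable _ _)
      (hf_cont.stronglyMeasurableAtFilter _ _) hf_cont.continuousAt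
  set G : ℝ → ℂ := fun τ ↦ Gamma (seg τ) * Complex.exp (-P τ) with hG
  have hG_deriv : ∀ τ ∈ Icc (0:ℝ) 1, HasDerivAt G 0 τ := by
    intro τ hτ
    have hΓd := Complex.differentiableAt_Gamma _ (hpole τ hτ)
    have hΓ : HasDerivAt (fun τ : ℝ ↦ Gamma (seg τ)) (deriv Gamma (seg τ) * d) τ := by
      have h1 : HasDerivAt (fun z : ℂ ↦ Gamma (w₀ + z * d)) (deriv Gamma (seg τ) * d) (τ : ℂ) := by
        have hi : HasDerivAt (fun z : ℂ ↦ w₀ + z * d) d (τ : ℂ) := by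
          simpa using ((hasDerivAt_id (τ : ℂ)).mul_const d).const_add w₀
        exact hΓd.hasDerivAt.comp (τ : ℂ) hi
      exact h1.comp_ofReal
    have hE : HasDerivAt (fun τ : ℝ ↦ Complex.exp (-P τ)) (Complex.exp (-P τ) * -f τ) τ :=
      (hP_deriv τ).neg.cexp
    have hprod := hΓ.mul hE
    have hdΓ : deriv Gamma (seg τ) = digamma (seg τ) * Gamma (seg τ) := by
      rw [Complex.digamma_def, logDeriv_apply, div_mul_cancel₀ _ (Complex.Gamma_ne_zero (hpole τ hτ))]
    have hfτ : f τ = digamma (seg τ) * d := by simp only [hf, hcl_id τ hτ]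
    have hzero : deriv Gamma (seg τ) * d * Complex.exp (-P τ) +
        Gamma (seg τ) * (Complex.exp (-P τ) * -f τ) = 0 := by
      rw [hdΓ, hfτ]; ring
    rw [hzero] at hprod
    exact hprod
  have hG_cont : ContinuousOn G (Icc 0 1) := fun τ hτ ↦ (hG_deriv τ hτ).continuousAt.continuousWithinAt
  have hconst := constant_of_has_deriv_right_zero hG_cont
    (fun τ hτ ↦ (hG_deriv τ (Ico_subset_Icc_self hτ)).hasDerivWithinAt) 1 ⟨zero_le_one, le_rfl⟩
  have hP0 : P 0 = 0 := by simp [hP]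
  have hseg0 : seg 0 = w₀ := by simp [hseg]
  have hseg1 : seg 1 = w := by simp [hseg, hd]
  have hP1 : P 1 = ∫ τ in (0:ℝ)..1, digamma (w₀ + τ * (w - w₀)) * (w - w₀) := by
    simp only [hP]
    refine intervalIntegral.integral_congr fun σ hσ ↦ ?_
    rw [Set.uIcc_of_le zero_le_one] at hσ
    simp only [hf, hseg, hcl_id σ hσ, hd]
  simp only [hG, hseg0, hseg1, hP0, neg_zero, Complex.exp_zero, mul_one] at hconst
  rw [← hP1, ← hconst, mul_assoc, ← Complex.exp_add, neg_add_cancel, Complex.exp_zero, mul_one]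

/-- **Uniform `Γ`-ratio bound in the sector `Re w ≥ ½`** (RH-free): for `a ≥ 0`,
`‖Γ(w)‖ ≤ e^{3a} ‖w‖^{−a} ‖Γ(w + a)‖`, since `log ‖Γ(w+a)‖ − log ‖Γ(w)‖ = ∫₀^a Re ψ(w+t) dt ≥ a (log ‖w‖ − 3)`.
This is the `Γ`-part of Suzuki's (4.2) `|E(z)| ≍ |z|^{…}` on vertical data, in a form uniform in `Re w`.
[cite: Suzuki2021Hamiltonians, §4.1 eq. (4.2)] -/
theorem norm_Gamma_le_exp_mul_rpow_mul_norm_Gamma_add {w : ℂ} (hw : 1 / 2 ≤ w.re) {a : ℝ} (ha : 0 ≤ a) :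
    ‖Gamma w‖ ≤ Real.exp (3 * a) * ‖w‖ ^ (-a) * ‖Gamma (w + a)‖ := by
  have hw0 : 0 < w.re := by linarith
  have hwa : 0 < (w + a).re := by simp; linarith
  have hnorm : 0 < ‖w‖ := lt_of_lt_of_le hw0 (Complex.re_le_norm w)
  have h := Gamma_eq_mul_exp_integral_digamma_of_re_pos hw0 hwa
  simp only [add_sub_cancel_left] at h
  -- the integrand along the segment and its real part
  have hcont : ContinuousOn (fun τ : ℝ => digamma (w + τ * (a : ℂ)) * (a : ℂ)) (uIcc 0 1) := by
    rw [uIcc_of_le zero_le_one]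
    refine ContinuousOn.mul ?_ continuousOn_const
    refine differentiableOn_digamma.continuousOn.comp (by fun_prop) fun τ hτ => ?_
    simp only [mem_setOf_eq, add_re, mul_re, ofReal_re, ofReal_im, zero_mul, sub_zero]
    nlinarith [hτ.1]
  have hint : IntervalIntegrable (fun τ : ℝ => digamma (w + τ * (a : ℂ)) * (a : ℂ)) volume 0 1 :=
    hcont.intervalIntegrable
  have hre_int : (∫ τ in (0:ℝ)..1, digamma (w + τ * (a : ℂ)) * (a : ℂ)).re =
      ∫ τ in (0:ℝ)..1, (digamma (w + τ * (a : ℂ)) * (a : ℂ)).re := by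
    have := intervalIntegral.intervalIntegral_re hint
    simpa using this.symm
  have hlow : ∀ τ ∈ Icc (0:ℝ) 1, a * (Real.log ‖w‖ - 3) ≤ (digamma (w + τ * (a : ℂ)) * (a : ℂ)).re := by
    intro τ hτ
    rw [Complex.mul_re, Complex.ofReal_re, Complex.ofReal_im, mul_zero, sub_zero]
    have hwt : 1 / 2 ≤ (w + τ * (a : ℂ)).re := by
      simp only [add_re, mul_re, ofReal_re, ofReal_im, zero_mul, sub_zero]
      nlinarith [hτ.1]
    have h1 := log_norm_sub_three_le_re_digamma hwt
    have h2 : Real.log ‖w‖ ≤ Real.log ‖w + τ * (a : ℂ)‖ := by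
      apply Real.log_le_log hnorm
      have e1 : ‖w‖ ^ 2 ≤ ‖w + τ * (a : ℂ)‖ ^ 2 := by
        rw [Complex.sq_norm, Complex.sq_norm, Complex.normSq_apply, Complex.normSq_apply]
        simp only [add_re, mul_re, ofReal_re, ofReal_im, zero_mul, sub_zero, add_im, mul_im,
          add_zero]
        nlinarith [mul_nonneg hτ.1 ha]
      nlinarith [norm_nonneg w, norm_nonneg (w + τ * (a : ℂ))]
    nlinarith
  have hint_low : a * (Real.log ‖w‖ - 3) ≤ ∫ τ in (0:ℝ)..1, (digamma (w + τ * (a : ℂ)) * (a : ℂ)).re := by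
    have hmono := intervalIntegral.integral_mono_on zero_le_one
      (intervalIntegrable_const (c := a * (Real.log ‖w‖ - 3)) (μ := volume) (a := 0) (b := 1))
      ((continuous_re.comp_continuousOn hcont).intervalIntegrable.congr ?_) hlow
    · simpa using hmono
    · exact fun _ _ => rfl
  -- conclude
  rw [h, norm_mul, Complex.norm_exp, hre_int]
  have hexp : ‖w‖ ^ (-a) = Real.exp (-(a * Real.log ‖w‖)) := by
    rw [Real.rpow_def_of_pos hnorm]; ring_nf
  rw [hexp]
  have hΓ : 0 ≤ ‖Gamma w‖ := norm_nonneg _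
  calc ‖Gamma w‖ = Real.exp (3 * a) * Real.exp (-(a * Real.log ‖w‖)) *
        (‖Gamma w‖ * Real.exp (a * (Real.log ‖w‖ - 3))) := by
          rw [mul_assoc, mul_comm (‖Gamma w‖), ← mul_assoc, ← mul_assoc, ← Real.exp_add, ← Real.exp_add]
          have : 3 * a + -(a * Real.log ‖w‖) + a * (Real.log ‖w‖ - 3) = 0 := by ring
          rw [this, Real.exp_zero, one_mul]
    _ ≤ Real.exp (3 * a) * Real.exp (-(a * Real.log ‖w‖)) *
        (‖Gamma w‖ * Real.exp (∫ τ in (0:ℝ)..1, (digamma (w + τ * (a : ℂ)) * (a : ℂ)).re)) := by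
          gcongr

/-! ## §2 The symbols `Θ = (ξ(s−ω)/ξ(s+ω))^ν`, `Θ_∞ = (γ(s−ω)/γ(s+ω))^ν` on the lines `Im z = v ≥ v₀ > ½ + ω` -/

open LSeries in
open scoped LSeries.notation in
/-- `|L f (s)| ≤ Σ ‖f(n)‖ n^{-σ₀}` for `Re s ≥ σ₀` when the right-hand side converges. [folklore] -/
private theorem norm_LSeries_le_tsum {f : ℕ → ℂ} {σ₀ : ℝ} (hsum : LSeriesSummable f (σ₀ : ℂ))
    {s : ℂ} (hs : σ₀ ≤ s.re) : ‖L f s‖ ≤ ∑' n : ℕ, ‖term f (σ₀ : ℂ) n‖ := by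
  have hsum0 : Summable fun n ↦ ‖term f (σ₀ : ℂ) n‖ := summable_norm_iff.mpr hsum
  have hle : ∀ n, ‖term f s n‖ ≤ ‖term f (σ₀ : ℂ) n‖ := fun n ↦
    norm_term_le_of_re_le_re _ (by simpa using hs) n
  have hsum1 : Summable fun n ↦ ‖term f s n‖ :=
    Summable.of_nonneg_of_le (fun _ ↦ norm_nonneg _) hle hsum0
  calc ‖L f s‖ = ‖∑' n, term f s n‖ := rfl
    _ ≤ ∑' n, ‖term f s n‖ := norm_tsum_le_tsum_norm hsum1
    _ ≤ ∑' n, ‖term f (σ₀ : ℂ) n‖ := hsum1.tsum_le_tsum hle hsum0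

open LSeries in
open scoped LSeries.notation in
/-- `|ζ(s)| ≤ Σ n^{-σ₀}` for `Re s ≥ σ₀ > 1`. [cite: Titchmarsh1986, §2.12] -/
theorem norm_riemannZeta_le_tsum {σ₀ : ℝ} (hσ₀ : 1 < σ₀) {s : ℂ} (hs : σ₀ ≤ s.re) :
    ‖riemannZeta s‖ ≤ ∑' n : ℕ, ‖term (1 : ℕ → ℂ) (σ₀ : ℂ) n‖ := by
  have hs1 : 1 < s.re := by linarith
  rw [← LSeries_one_eq_riemannZeta hs1]
  exact norm_LSeries_le_tsum (LSeriesSummable_one_iff.2 (by simpa using hσ₀)) hs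

open LSeries in
open scoped LSeries.notation ArithmeticFunction.Moebius in
/-- `|1/ζ(s)| = |Σ μ(n) n^{-s}| ≤ Σ n^{-σ₀}` for `Re s ≥ σ₀ > 1`. [cite: Titchmarsh1986, §2.12] -/
theorem norm_inv_riemannZeta_le_tsum {σ₀ : ℝ} (hσ₀ : 1 < σ₀) {s : ℂ} (hs : σ₀ ≤ s.re) :
    ‖(riemannZeta s)⁻¹‖ ≤ ∑' n : ℕ, ‖term (fun n ↦ (ArithmeticFunction.moebius n : ℂ)) (σ₀ : ℂ) n‖ := by
  have hs1 : 1 < s.re := by linarith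
  have hmul := LSeries_one_mul_Lseries_moebius hs1
  rw [LSeries_one_eq_riemannZeta hs1] at hmul
  rw [← (eq_inv_of_mul_eq_one_right hmul)]
  exact norm_LSeries_le_tsum (ArithmeticFunction.LSeriesSummable_moebius_iff.2 (by simpa using hσ₀)) hs

/-- `γ(s) = ½ s(s−1) Γ_ℝ(s) ≠ 0` for `Re s > 1`. [folklore] -/
private theorem xiGammaFactor_ne_zero_of_one_lt_re {s : ℂ} (hs : 1 < s.re) : xiGammaFactor s ≠ 0 := by
  have hs0 : s ≠ 0 := fun h ↦ by rw [h] at hs; norm_num at hs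
  have hs1 : s - 1 ≠ 0 := fun h ↦ by
    have : s = 1 := sub_eq_zero.1 h
    rw [this] at hs; norm_num at hs
  unfold xiGammaFactor
  exact mul_ne_zero (div_ne_zero (mul_ne_zero hs0 hs1) two_ne_zero)
    (Gammaℝ_ne_zero_of_re_pos (by linarith))

/-- **The `γ`-ratio**: for `Re S ≥ 1` and `ω ≥ 0`,
`‖γ(S)‖ ≤ π^ω e^{3ω} ‖S/2‖^{−ω} ‖γ(S + 2ω)‖` (`γ = ½ s(s−1)π^{−s/2}Γ(s/2)`: the polynomial and `π`-parts are
monotone in `Re`, the `Γ`-part is §1). [cite: Suzuki2021Hamiltonians, §4.1 eq. (4.2)] -/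
theorem norm_xiGammaFactor_le_shift {S : ℂ} (hS : 1 ≤ S.re) {ω : ℝ} (hω : 0 ≤ ω) :
    ‖xiGammaFactor S‖ ≤ π ^ ω * Real.exp (3 * ω) * ‖S / 2‖ ^ (-ω) * ‖xiGammaFactor (S + 2 * ω)‖ := by
  unfold xiGammaFactor
  rw [Gammaℝ_def, Gammaℝ_def]
  have hS2 : 1 / 2 ≤ (S / 2).re := by simp; linarith
  -- the Γ part
  have hΓ := norm_Gamma_le_exp_mul_rpow_mul_norm_Gamma_add hS2 hω
  have hT2 : S / 2 + (ω : ℂ) = (S + 2 * ω) / 2 := by ring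
  rw [hT2] at hΓ
  -- the π part
  have hπS : ‖(π : ℂ) ^ (-S / 2)‖ = π ^ (-S.re / 2) := by
    rw [Complex.norm_cpow_eq_rpow_re_of_pos Real.pi_pos]; simp
  have hπT : ‖(π : ℂ) ^ (-(S + 2 * ω) / 2)‖ = π ^ (-S.re / 2 - ω) := by
    rw [Complex.norm_cpow_eq_rpow_re_of_pos Real.pi_pos]; congr 1; simp; ring
  have hπrel : (π : ℝ) ^ (-S.re / 2) = π ^ ω * π ^ (-S.re / 2 - ω) := by
    rw [← Real.rpow_add Real.pi_pos]; ring_nf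
  -- the polynomial part
  have hpoly1 : ‖S‖ ≤ ‖S + 2 * ω‖ := by
    have h1 : ‖S‖ ^ 2 ≤ ‖S + 2 * ω‖ ^ 2 := by
      rw [Complex.sq_norm, Complex.sq_norm, Complex.normSq_apply, Complex.normSq_apply]
      simp only [add_re, mul_re, ofReal_re, ofReal_im, add_im, mul_im]
      norm_num
      nlinarith
    exact (pow_le_pow_iff_left₀ (norm_nonneg _) (norm_nonneg _) two_ne_zero).1 h1
  have hpoly2 : ‖S - 1‖ ≤ ‖S + 2 * ω - 1‖ := by
    have h1 : ‖S - 1‖ ^ 2 ≤ ‖S + 2 * ω - 1‖ ^ 2 := by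
      rw [Complex.sq_norm, Complex.sq_norm, Complex.normSq_apply, Complex.normSq_apply]
      simp only [add_re, mul_re, ofReal_re, ofReal_im, add_im, mul_im, sub_re, sub_im, one_re, one_im]
      norm_num
      nlinarith
    exact (pow_le_pow_iff_left₀ (norm_nonneg _) (norm_nonneg _) two_ne_zero).1 h1
  have e1 : ‖S * (S - 1) / 2 * ((π : ℂ) ^ (-S / 2) * Gamma (S / 2))‖ =
      ‖S‖ * ‖S - 1‖ / 2 * (π ^ ω * π ^ (-S.re / 2 - ω) * ‖Gamma (S / 2)‖) := by
    simp only [norm_mul, norm_div, Complex.norm_two]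
    rw [hπS, hπrel]
  have e2 : ‖(S + 2 * ω) * (S + 2 * ω - 1) / 2 * ((π : ℂ) ^ (-(S + 2 * ω) / 2) * Gamma ((S + 2 * ω) / 2))‖ =
      ‖S + 2 * ω‖ * ‖S + 2 * ω - 1‖ / 2 * (π ^ (-S.re / 2 - ω) * ‖Gamma ((S + 2 * ω) / 2)‖) := by
    simp only [norm_mul, norm_div, Complex.norm_two]
    rw [hπT]
  rw [e1, e2]
  have hπω : 0 ≤ (π : ℝ) ^ ω := by positivity
  have hπr : 0 ≤ (π : ℝ) ^ (-S.re / 2 - ω) := by positivity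
  calc ‖S‖ * ‖S - 1‖ / 2 * (π ^ ω * π ^ (-S.re / 2 - ω) * ‖Gamma (S / 2)‖)
      ≤ ‖S + 2 * ω‖ * ‖S + 2 * ω - 1‖ / 2 *
          (π ^ ω * π ^ (-S.re / 2 - ω) * (Real.exp (3 * ω) * ‖S / 2‖ ^ (-ω) * ‖Gamma ((S + 2 * ω) / 2)‖)) := by
        gcongr
    _ = π ^ ω * Real.exp (3 * ω) * ‖S / 2‖ ^ (-ω) *
          (‖S + 2 * ω‖ * ‖S + 2 * ω - 1‖ / 2 * (π ^ (-S.re / 2 - ω) * ‖Gamma ((S + 2 * ω) / 2)‖)) := by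
        ring


/-- Ratio form of `norm_xiGammaFactor_le_shift`: `‖γ(S)/γ(S+2ω)‖ ≤ π^ω e^{3ω} ‖S/2‖^{−ω}` for `Re S ≥ 1`,
`ω ≥ 0`. [cite: Suzuki2021Hamiltonians, §4.1 eq. (4.2)] -/
theorem norm_xiGammaFactor_div_le {S : ℂ} (hS : 1 ≤ S.re) {ω : ℝ} (hω : 0 ≤ ω) :
    ‖xiGammaFactor S / xiGammaFactor (S + 2 * ω)‖ ≤ π ^ ω * Real.exp (3 * ω) * ‖S / 2‖ ^ (-ω) := by
  rcases eq_or_lt_of_le hω with h0 | hpos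
  · -- ω = 0: the ratio is 1 (or junk 0/0 = 0)
    subst h0
    simp only [Complex.ofReal_zero, mul_zero, add_zero, Real.rpow_zero, Real.exp_zero, neg_zero,
      mul_one, Real.rpow_zero]
    by_cases h : xiGammaFactor S = 0
    · simp [h]
    · simp [div_self h]
  have hT : xiGammaFactor (S + 2 * ω) ≠ 0 :=
    xiGammaFactor_ne_zero_of_one_lt_re (by simp; linarith)
  rw [norm_div, div_le_iff₀ (norm_pos_iff.2 hT)]
  exact norm_xiGammaFactor_le_shift hS hω

/-- `½ ∓ ω − i(u + iv)` in coordinates. [folklore] -/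
private theorem half_sub_omega_line (ω u v : ℝ) :
    (1 : ℂ) / 2 - (ω : ℂ) - I * ((u : ℂ) + (v : ℂ) * I) = (((1 / 2 - ω + v : ℝ)) : ℂ) + ((-u : ℝ) : ℂ) * I := by
  push_cast
  linear_combination (-(v : ℂ)) * I_mul_I

/-- `½ + ω − iz = (½ − ω − iz) + 2ω`. [folklore] -/
private theorem half_add_omega_eq (ω : ℝ) (z : ℂ) :
    (1 : ℂ) / 2 + (ω : ℂ) - I * z = ((1 : ℂ) / 2 - (ω : ℂ) - I * z) + 2 * (ω : ℂ) := by ring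

/-- `Re(½ − ω − i(u+iv)) = ½ − ω + v`. [folklore] -/
private theorem re_half_sub_omega_line (ω u v : ℝ) :
    ((1 : ℂ) / 2 - (ω : ℂ) - I * ((u : ℂ) + (v : ℂ) * I)).re = 1 / 2 - ω + v := by
  rw [half_sub_omega_line]; simp

/-- `Im(½ − ω − i(u+iv)) = −u`. [folklore] -/
private theorem im_half_sub_omega_line (ω u v : ℝ) :
    ((1 : ℂ) / 2 - (ω : ℂ) - I * ((u : ℂ) + (v : ℂ) * I)).im = -u := by
  rw [half_sub_omega_line]; simp

/-- `‖S/2‖ ≥ (1+|u|)/4` for `S = σ − iu` with `σ ≥ 1`. [folklore] -/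
private theorem norm_div_two_ge {S : ℂ} (hS : 1 ≤ S.re) : (1 + |S.im|) / 4 ≤ ‖S / 2‖ := by
  rw [norm_div, Complex.norm_two]
  have h1 : S.re ≤ ‖S‖ := Complex.re_le_norm S
  have h2 : |S.im| ≤ ‖S‖ := Complex.abs_im_le_norm S
  rcases le_or_gt |S.im| 1 with h | h
  · linarith
  · linarith

/-- `((1+|u|)/4)^{-ω}`-type step: `‖S/2‖^{−ω} ≤ 4^ω (1+|Im S|)^{−ω}` for `Re S ≥ 1`, `ω ≥ 0`. [folklore] -/
private theorem norm_div_two_rpow_neg_le {S : ℂ} (hS : 1 ≤ S.re) {ω : ℝ} (hω : 0 ≤ ω) :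
    ‖S / 2‖ ^ (-ω) ≤ (4 : ℝ) ^ ω * (1 + |S.im|) ^ (-ω) := by
  have hpos : 0 < (1 + |S.im|) / 4 := by positivity
  have h := Real.rpow_le_rpow_of_nonpos hpos (norm_div_two_ge hS) (by linarith : -ω ≤ 0)
  refine h.trans (le_of_eq ?_)
  rw [Real.div_rpow (by positivity) (by norm_num), Real.rpow_neg (by norm_num : (0:ℝ) ≤ 4),
    inv_eq_one_div]
  field_simp

/-- **Uniform decay of the archimedean symbol** (RH-free): for `ω > 0`, `ν`, and `v₀ ≥ ½ + ω` there is
`C > 0` with `‖Θ_∞(u + iv)‖ ≤ C (1 + |u|)^{−νω}` for all `v ≥ v₀`, `u ∈ ℝ`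
(`Θ_∞ = suzukiThetaArch ω ν = (γ(½−ω−iz)/γ(½+ω−iz))^ν`). [cite: Suzuki2021Hamiltonians, §4.1 eq. (4.2)] -/
theorem norm_suzukiThetaArch_line_le {ω : ℝ} (hω : 0 < ω) (ν : ℕ) {v₀ : ℝ} (hv₀ : 1 / 2 + ω ≤ v₀) :
    ∃ C : ℝ, 0 < C ∧ ∀ v : ℝ, v₀ ≤ v → ∀ u : ℝ,
      ‖suzukiThetaArch ω ν ((u : ℂ) + (v : ℂ) * I)‖ ≤ C * (1 + |u|) ^ (-((ν : ℝ) * ω)) := by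
  set C₀ : ℝ := π ^ ω * Real.exp (3 * ω) * (4 : ℝ) ^ ω with hC₀
  have hC₀pos : 0 < C₀ := by positivity
  refine ⟨C₀ ^ ν, by positivity, fun v hv u => ?_⟩
  set S : ℂ := (1 : ℂ) / 2 - (ω : ℂ) - I * ((u : ℂ) + (v : ℂ) * I) with hSdef
  have hSre : 1 ≤ S.re := by rw [hSdef, re_half_sub_omega_line]; linarith
  have hSim : S.im = -u := by rw [hSdef, im_half_sub_omega_line]
  have hbase : ‖xiGammaFactor S / xiGammaFactor (S + 2 * ω)‖ ≤ C₀ * (1 + |u|) ^ (-ω) := by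
    have h1 := norm_xiGammaFactor_div_le hSre hω.le
    have h2 := norm_div_two_rpow_neg_le hSre hω.le
    rw [hSim, abs_neg] at h2
    calc ‖xiGammaFactor S / xiGammaFactor (S + 2 * ω)‖ ≤ π ^ ω * Real.exp (3 * ω) * ‖S / 2‖ ^ (-ω) := h1
      _ ≤ π ^ ω * Real.exp (3 * ω) * ((4 : ℝ) ^ ω * (1 + |u|) ^ (-ω)) := by gcongr
      _ = C₀ * (1 + |u|) ^ (-ω) := by rw [hC₀]; ring
  unfold suzukiThetaArch
  rw [half_add_omega_eq, ← hSdef, norm_pow]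
  calc ‖xiGammaFactor S / xiGammaFactor (S + 2 * ω)‖ ^ ν ≤ (C₀ * (1 + |u|) ^ (-ω)) ^ ν :=
        pow_le_pow_left₀ (norm_nonneg _) hbase ν
    _ = C₀ ^ ν * (1 + |u|) ^ (-((ν : ℝ) * ω)) := by
        rw [mul_pow, ← Real.rpow_natCast ((1 + |u|) ^ (-ω)) ν, ← Real.rpow_mul (by positivity)]
        congr 2; ring

open LSeries in
open scoped LSeries.notation in
/-- **Uniform decay of the symbol `Θ`** (RH-free): for `ω > 0`, `ν`, and `v₀ > ½ + ω` there is `C > 0` with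
`‖Θ(u + iv)‖ ≤ C (1 + |u|)^{−νω}` for all `v ≥ v₀`, `u ∈ ℝ` (`Θ = suzukiTheta ω ν`; `ξ = γ ζ` on
`Re s > 1`, the `γ`-ratio by §1, `|ζ(s−ω)| ≤ Σn^{−σ₁}`, `|ζ(s+ω)|⁻¹ ≤ Σ n^{−σ₁−2ω}`, `σ₁ = ½ − ω + v₀ > 1`).
This is Suzuki's (4.2)-type decay, which makes (2.6) absolutely convergent exactly when `νω > 1`.
[cite: Suzuki2021Hamiltonians, §4.1 eq. (4.2) and §2 (2.6)] -/
theorem norm_suzukiTheta_line_le {ω : ℝ} (hω : 0 < ω) (ν : ℕ) {v₀ : ℝ} (hv₀ : 1 / 2 + ω < v₀) :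
    ∃ C : ℝ, 0 < C ∧ ∀ v : ℝ, v₀ ≤ v → ∀ u : ℝ,
      ‖suzukiTheta ω ν ((u : ℂ) + (v : ℂ) * I)‖ ≤ C * (1 + |u|) ^ (-((ν : ℝ) * ω)) := by
  set σ₁ : ℝ := 1 / 2 - ω + v₀ with hσ₁
  have hσ₁1 : 1 < σ₁ := by rw [hσ₁]; linarith
  set Z : ℝ := ∑' n : ℕ, ‖term (1 : ℕ → ℂ) (σ₁ : ℂ) n‖ with hZ
  set M : ℝ := ∑' n : ℕ, ‖term (fun n ↦ (ArithmeticFunction.moebius n : ℂ)) ((σ₁ + 2 * ω : ℝ) : ℂ) n‖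
    with hM
  have hZ0 : 0 ≤ Z := tsum_nonneg fun _ => norm_nonneg _
  have hM0 : 0 ≤ M := tsum_nonneg fun _ => norm_nonneg _
  set C₀ : ℝ := π ^ ω * Real.exp (3 * ω) * (4 : ℝ) ^ ω * (Z * M) + 1 with hC₀
  have hC₀pos : 0 < C₀ := by positivity
  refine ⟨C₀ ^ ν, by positivity, fun v hv u => ?_⟩
  set S : ℂ := (1 : ℂ) / 2 - (ω : ℂ) - I * ((u : ℂ) + (v : ℂ) * I) with hSdef
  have hSre' : σ₁ ≤ S.re := by rw [hSdef, re_half_sub_omega_line, hσ₁]; linarith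
  have hSre1 : 1 < S.re := lt_of_lt_of_le hσ₁1 hSre'
  have hSre : 1 ≤ S.re := hSre1.le
  have hTre : σ₁ + 2 * ω ≤ (S + 2 * ω).re := by simp; linarith
  have hSim : S.im = -u := by rw [hSdef, im_half_sub_omega_line]
  -- `ξ = γ ζ` at `S` and at `T = S + 2ω`
  have hξS : riemannXi S = xiGammaFactor S * riemannZeta S :=
    (xiGammaFactor_mul_riemannZeta (fun h => by rw [h] at hSre1; norm_num at hSre1)
      (Gammaℝ_ne_zero_of_re_pos (by linarith))).symm
  have hξT : riemannXi (S + 2 * ω) = xiGammaFactor (S + 2 * ω) * riemannZeta (S + 2 * ω) :=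
    (xiGammaFactor_mul_riemannZeta (fun h => by
        have := congrArg Complex.re h; simp at this; linarith)
      (Gammaℝ_ne_zero_of_re_pos (by simp; linarith))).symm
  have hbase : ‖riemannXi S / riemannXi (S + 2 * ω)‖ ≤ C₀ * (1 + |u|) ^ (-ω) := by
    rw [hξS, hξT, mul_div_mul_comm, norm_mul]
    have h1 := norm_xiGammaFactor_div_le hSre hω.le
    have h2 := norm_div_two_rpow_neg_le hSre hω.le
    rw [hSim, abs_neg] at h2
    have h3 : ‖riemannZeta S / riemannZeta (S + 2 * ω)‖ ≤ Z * M := by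
      rw [div_eq_mul_inv, norm_mul]
      exact mul_le_mul (norm_riemannZeta_le_tsum hσ₁1 hSre')
        (norm_inv_riemannZeta_le_tsum (by linarith) (by simpa using hTre)) (norm_nonneg _) hZ0
    have hr : 0 ≤ (1 + |u|) ^ (-ω) := Real.rpow_nonneg (by positivity) _
    calc ‖xiGammaFactor S / xiGammaFactor (S + 2 * ω)‖ * ‖riemannZeta S / riemannZeta (S + 2 * ω)‖
        ≤ (π ^ ω * Real.exp (3 * ω) * ((4 : ℝ) ^ ω * (1 + |u|) ^ (-ω))) * (Z * M) :=
          mul_le_mul (h1.trans (by gcongr)) h3 (norm_nonneg _) (by positivity)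
      _ = (π ^ ω * Real.exp (3 * ω) * (4 : ℝ) ^ ω * (Z * M)) * (1 + |u|) ^ (-ω) := by ring
      _ ≤ C₀ * (1 + |u|) ^ (-ω) := by
          apply mul_le_mul_of_nonneg_right _ hr
          rw [hC₀]; linarith
  unfold suzukiTheta
  rw [half_add_omega_eq, ← hSdef, norm_pow]
  calc ‖riemannXi S / riemannXi (S + 2 * ω)‖ ^ ν ≤ (C₀ * (1 + |u|) ^ (-ω)) ^ ν :=
        pow_le_pow_left₀ (norm_nonneg _) hbase ν
    _ = C₀ ^ ν * (1 + |u|) ^ (-((ν : ℝ) * ω)) := by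
        rw [mul_pow, ← Real.rpow_natCast ((1 + |u|) ^ (-ω)) ν, ← Real.rpow_mul (by positivity)]
        congr 2; ring

/-! ## §3 Generic consequences of uniform polynomial decay on the lines `Im z = v ≥ v₀` -/

section Generic

variable {Φ : ℂ → ℂ} {v₀ r C : ℝ}

/-- `‖e^{−i(u+iv)x}‖ = e^{vx}`. [folklore] -/
private theorem norm_cexp_neg_I_line' (v x u : ℝ) :
    ‖Complex.exp (-I * ((u : ℂ) + (v : ℂ) * I) * (x : ℂ))‖ = Real.exp (v * x) := by
  rw [Complex.norm_exp]
  congr 1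
  simp only [Complex.mul_re, Complex.mul_im, Complex.neg_re, Complex.neg_im, Complex.add_re,
    Complex.add_im, Complex.I_re, Complex.I_im, Complex.ofReal_re, Complex.ofReal_im]
  ring

/-- The majorant `(1 + |u|)^{−r}` is integrable on `ℝ` for `r > 1`. [folklore] -/
private theorem integrable_one_add_abs_rpow_neg' (hr : 1 < r) :
    Integrable fun u : ℝ => (1 + |u|) ^ (-r) := by
  have h := integrable_one_add_norm (E := ℝ) (μ := volume) (r := r) (by simpa using hr)
  simpa [Real.norm_eq_abs] using h

/-- Continuity along the lines from holomorphy on the closed half-plane `Im z ≥ v₀`. [folklore] -/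
private theorem continuous_line_of_differentiableOn (hd : DifferentiableOn ℂ Φ {z : ℂ | v₀ ≤ z.im})
    {v : ℝ} (hv : v₀ ≤ v) : Continuous fun u : ℝ => Φ ((u : ℂ) + (v : ℂ) * I) :=
  hd.continuousOn.comp_continuous (by fun_prop : Continuous fun u : ℝ => (u : ℂ) + (v : ℂ) * I)
    fun u => by simpa using hv

/-- Integrability of the symbol along a line, from continuity and the decay. [folklore] -/
private theorem integrable_line_of_decay (hr : 1 < r) (hd : DifferentiableOn ℂ Φ {z : ℂ | v₀ ≤ z.im})
    (hC : ∀ v : ℝ, v₀ ≤ v → ∀ u : ℝ, ‖Φ ((u : ℂ) + (v : ℂ) * I)‖ ≤ C * (1 + |u|) ^ (-r))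
    {v : ℝ} (hv : v₀ ≤ v) : Integrable fun u : ℝ => Φ ((u : ℂ) + (v : ℂ) * I) :=
  ((integrable_one_add_abs_rpow_neg' hr).const_mul C).mono'
    (continuous_line_of_differentiableOn hd hv).aestronglyMeasurable (Eventually.of_forall (hC v hv))

/-- Integrability of the inverse-Fourier integrand along a line. [folklore] -/
private theorem integrable_lineIntegrand_of_decay (hr : 1 < r)
    (hd : DifferentiableOn ℂ Φ {z : ℂ | v₀ ≤ z.im})
    (hC : ∀ v : ℝ, v₀ ≤ v → ∀ u : ℝ, ‖Φ ((u : ℂ) + (v : ℂ) * I)‖ ≤ C * (1 + |u|) ^ (-r))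
    {v : ℝ} (hv : v₀ ≤ v) (x : ℝ) :
    Integrable fun u : ℝ => Φ ((u : ℂ) + (v : ℂ) * I) * Complex.exp (-I * ((u : ℂ) + (v : ℂ) * I) * (x : ℂ)) := by
  have hI := integrable_line_of_decay hr hd hC hv
  refine (hI.norm.mul_const (Real.exp (v * x))).mono' ?_ (Eventually.of_forall fun u => ?_)
  · exact hI.1.mul (by fun_prop : Continuous fun u : ℝ =>
      Complex.exp (-I * ((u : ℂ) + (v : ℂ) * I) * (x : ℂ))).aestronglyMeasurable
  · rw [norm_mul, norm_cexp_neg_I_line']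

/-- **Line independence from uniform decay** (RH-free, generic): if `Φ` is holomorphic on `Im z ≥ v₀` and
`‖Φ(u+iv)‖ ≤ C(1+|u|)^{−r}` (`r > 1`) uniformly in `v ≥ v₀`, then `invFourierLine Φ v x` does not depend
on `v ≥ v₀` (Cauchy on rectangles, `integral_line_eq_of_differentiableOn_strip`).
[cite: Suzuki2020IntegralOperators, §3, proof of Prop. 3.1] -/
theorem invFourierLine_eq_of_decay (hr : 1 < r) (hd : DifferentiableOn ℂ Φ {z : ℂ | v₀ ≤ z.im})
    (hC : ∀ v : ℝ, v₀ ≤ v → ∀ u : ℝ, ‖Φ ((u : ℂ) + (v : ℂ) * I)‖ ≤ C * (1 + |u|) ^ (-r))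
    {v₁ v₂ : ℝ} (hv₁ : v₀ ≤ v₁) (hv₂ : v₀ ≤ v₂) (x : ℝ) :
    invFourierLine Φ v₁ x = invFourierLine Φ v₂ x := by
  wlog hle : v₁ ≤ v₂ generalizing v₁ v₂
  · exact (this hv₂ hv₁ (le_of_not_ge hle)).symm
  have hC0 : 0 ≤ C := by
    have h := hC v₁ hv₁ 0
    have h1 : (0 : ℝ) < (1 + |(0:ℝ)|) ^ (-r) := Real.rpow_pos_of_pos (by norm_num) _
    nlinarith [norm_nonneg (Φ ((0:ℝ) + (v₁ : ℂ) * I))]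
  unfold invFourierLine
  congr 1
  set g : ℂ → ℂ := fun z => Φ z * Complex.exp (-I * z * (x : ℂ)) with hg
  have key := integral_line_eq_of_differentiableOn_strip (g := g) hle ?_ ?_ ?_
    (h := fun R => C * (1 + R) ^ (-r) * Real.exp (max (v₁ * x) (v₂ * x))) ?_ ?_
  · simpa [hg] using key
  · intro z hz
    exact ((hd z (le_trans hv₁ hz.1)).mul (by fun_prop)).mono fun w hw => le_trans hv₁ hw.1
  · exact integrable_lineIntegrand_of_decay hr hd hC hv₁ x
  · exact integrable_lineIntegrand_of_decay hr hd hC hv₂ x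
  · intro R y hy
    have h1 := hC y (le_trans hv₁ hy.1) R
    have h2 : ‖Complex.exp (-I * ((R : ℂ) + (y : ℂ) * I) * (x : ℂ))‖ ≤ Real.exp (max (v₁ * x) (v₂ * x)) := by
      rw [norm_cexp_neg_I_line', Real.exp_le_exp]
      rcases le_or_gt 0 x with hx | hx
      · exact le_trans (mul_le_mul_of_nonneg_right hy.2 hx) (le_max_right _ _)
      · exact le_trans (mul_le_mul_of_nonpos_right hy.1 hx.le) (le_max_left _ _)
    calc ‖g ((R : ℂ) + (y : ℂ) * I)‖
        = ‖Φ ((R : ℂ) + (y : ℂ) * I)‖ * ‖Complex.exp (-I * ((R : ℂ) + (y : ℂ) * I) * (x : ℂ))‖ := by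
          rw [hg]; exact norm_mul _ _
      _ ≤ C * (1 + |R|) ^ (-r) * Real.exp (max (v₁ * x) (v₂ * x)) :=
          mul_le_mul h1 h2 (norm_nonneg _) (by positivity)
  · have h1 : Tendsto (fun R : ℝ => (1 + R) ^ (-r)) atTop (𝓝 0) :=
      (tendsto_rpow_neg_atTop (by linarith : 0 < r)).comp (tendsto_atTop_add_const_left atTop 1 tendsto_id)
    have := (h1.const_mul C).mul_const (Real.exp (max (v₁ * x) (v₂ * x)))
    simpa using this

/-- Uniform growth of the line transforms: `‖invFourierLine Φ v x‖ ≤ D e^{vx}` for all `v ≥ v₀`, `x ∈ ℝ`,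
with `D = (2π)⁻¹ C ∫(1+|u|)^{−r} du`. [cite: Suzuki2020IntegralOperators, §3, proof of Prop. 3.1] -/
theorem norm_invFourierLine_le_of_decay (hr : 1 < r)
    (hC : ∀ v : ℝ, v₀ ≤ v → ∀ u : ℝ, ‖Φ ((u : ℂ) + (v : ℂ) * I)‖ ≤ C * (1 + |u|) ^ (-r)) :
    ∃ D : ℝ, 0 ≤ D ∧ ∀ v : ℝ, v₀ ≤ v → ∀ x : ℝ, ‖invFourierLine Φ v x‖ ≤ D * Real.exp (v * x) := by
  set M : ℝ := ∫ u : ℝ, (1 + |u|) ^ (-r) with hM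
  have hM0 : 0 ≤ M := integral_nonneg fun u => Real.rpow_nonneg (by positivity) _
  have hCM : ∀ v : ℝ, v₀ ≤ v → ∫ u : ℝ, ‖Φ ((u : ℂ) + (v : ℂ) * I)‖ ≤ C * M := by
    intro v hv
    rw [hM, ← integral_const_mul]
    exact integral_mono_of_nonneg (Eventually.of_forall fun u => norm_nonneg _)
      ((integrable_one_add_abs_rpow_neg' hr).const_mul C) (Eventually.of_forall fun u => hC v hv u)
  have hCM0 : 0 ≤ C * M := le_trans (integral_nonneg fun u => norm_nonneg _) (hCM v₀ le_rfl)
  refine ⟨1 / (2 * Real.pi) * (C * M), by positivity, fun v hv x => ?_⟩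
  calc ‖invFourierLine Φ v x‖
      ≤ 1 / (2 * Real.pi) * Real.exp (v * x) * ∫ u : ℝ, ‖Φ ((u : ℂ) + (v : ℂ) * I)‖ :=
        norm_invFourierLine_le _ _ _
    _ ≤ 1 / (2 * Real.pi) * Real.exp (v * x) * (C * M) := by gcongr; exact hCM v hv
    _ = 1 / (2 * Real.pi) * (C * M) * Real.exp (v * x) := by ring

/-- **Paley–Wiener vanishing from uniform decay** (RH-free, generic): under the hypotheses of
`invFourierLine_eq_of_decay`, `invFourierLine Φ v x = 0` for `v ≥ v₀` and `x < 0` (`v → +∞`).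
[cite: Suzuki2020IntegralOperators, §3, proof of Prop. 3.1] -/
theorem invFourierLine_eq_zero_of_decay (hr : 1 < r) (hd : DifferentiableOn ℂ Φ {z : ℂ | v₀ ≤ z.im})
    (hC : ∀ v : ℝ, v₀ ≤ v → ∀ u : ℝ, ‖Φ ((u : ℂ) + (v : ℂ) * I)‖ ≤ C * (1 + |u|) ^ (-r))
    {v : ℝ} (hv : v₀ ≤ v) {x : ℝ} (hx : x < 0) : invFourierLine Φ v x = 0 := by
  obtain ⟨D, hD0, hD⟩ := norm_invFourierLine_le_of_decay hr hC
  set V := invFourierLine Φ v x with hV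
  have hbound : ∀ v' : ℝ, v ≤ v' → ‖V‖ ≤ D * Real.exp (v' * x) := by
    intro v' hv'
    rw [hV, invFourierLine_eq_of_decay hr hd hC hv (le_trans hv hv') x]
    exact hD v' (le_trans hv hv') x
  have hlim : Tendsto (fun v' : ℝ => D * Real.exp (v' * x)) atTop (𝓝 0) := by
    have h1 : Tendsto (fun v' : ℝ => v' * x) atTop atBot := tendsto_id.atTop_mul_const_of_neg hx
    have := (Real.tendsto_exp_atBot.comp h1).const_mul D
    simpa using this
  have hle : ‖V‖ ≤ 0 :=
    ge_of_tendsto hlim (Filter.eventually_atTop.2 ⟨v, fun v' hv' => hbound v' hv'⟩)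
  exact norm_le_zero_iff.1 hle

/-- Continuity of the line transforms under uniform decay. [cite: Suzuki2021Hamiltonians, Prop. 4.1 (4)] -/
theorem continuous_invFourierLine_of_decay (hr : 1 < r) (hd : DifferentiableOn ℂ Φ {z : ℂ | v₀ ≤ z.im})
    (hC : ∀ v : ℝ, v₀ ≤ v → ∀ u : ℝ, ‖Φ ((u : ℂ) + (v : ℂ) * I)‖ ≤ C * (1 + |u|) ^ (-r))
    {v : ℝ} (hv : v₀ ≤ v) (hv0 : 0 ≤ v) : Continuous fun x : ℝ => invFourierLine Φ v x :=
  continuous_invFourierLine hv0 (integrable_lineIntegrand_of_decay hr hd hC hv)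

/-- Mathlib's inverse Fourier transform on `ℝ` as an explicit exponential integral. [folklore] -/
private theorem fourierInv_real_eq_integral_exp_smul'' (f : ℝ → ℂ) (w : ℝ) :
    𝓕⁻ f w = ∫ v : ℝ, Complex.exp (↑(2 * π * v * w) * I) • f v := by
  rw [Real.fourierInv_eq_fourier_neg, Real.fourier_real_eq_integral_exp_smul]
  congr 1 with v
  congr 2
  push_cast
  ring

/-- `‖e^{izx}‖ = e^{−(Im z) x}` for real `x`. [folklore] -/
private theorem norm_cexp_I_mul_mul_ofReal' (z : ℂ) (x : ℝ) :
    ‖Complex.exp (I * z * (x : ℂ))‖ = Real.exp (-(z.im * x)) := by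
  rw [Complex.norm_exp]
  congr 1
  simp only [Complex.mul_re, Complex.mul_im, Complex.I_re, Complex.I_im, Complex.ofReal_re,
    Complex.ofReal_im]
  ring

/-- The line transform in terms of Mathlib's Fourier transform of `φ_v = Φ(· + iv)`. [folklore] -/
private theorem invFourierLine_eq_fourier' (Φ : ℂ → ℂ) (b x : ℝ) :
    invFourierLine Φ b x = (1 : ℂ) / (2 * (Real.pi : ℂ)) *
      (Complex.exp ((b * x : ℝ) : ℂ) * 𝓕 (fun u : ℝ => Φ ((u : ℂ) + (b : ℂ) * I)) (x / (2 * π))) := by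
  unfold invFourierLine
  congr 1
  rw [Real.fourier_real_eq_integral_exp_smul, ← integral_const_mul]
  congr 1
  funext u
  have hreal : -2 * π * u * (x / (2 * π)) = -(u * x) := by
    field_simp
  rw [smul_eq_mul, hreal]
  have hexp : -I * ((u : ℂ) + (b : ℂ) * I) * (x : ℂ) = ((b * x : ℝ) : ℂ) + ((-(u * x) : ℝ) : ℂ) * I := by
    push_cast
    linear_combination (-(b : ℂ) * (x : ℂ)) * I_mul_I
  rw [hexp, Complex.exp_add]
  ring

/-- **Fourier–Laplace formula from uniform decay** (RH-free, generic): under the hypotheses of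
`invFourierLine_eq_of_decay`, for every reference line `v₁ ≥ v₀` and every `z` with `Im z > v₀`,
`x ↦ (invFourierLine Φ v₁ x) e^{izx}` is integrable on `ℝ` and `∫ (invFourierLine Φ v₁ x) e^{izx} dx = Φ(z)`
(Mathlib's `Continuous.fourierInv_fourier_eq` on the line `Im = Im z`, rescaled by `2π`; integrability of the
transform from the vanishing on `x < 0` and the growth bound on a line strictly between `v₀` and `Im z`).
[cite: Suzuki2020IntegralOperators, §3, proof of Prop. 3.1] -/
theorem integral_invFourierLine_mul_cexp_of_decay (hr : 1 < r)
    (hd : DifferentiableOn ℂ Φ {z : ℂ | v₀ ≤ z.im})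
    (hC : ∀ v : ℝ, v₀ ≤ v → ∀ u : ℝ, ‖Φ ((u : ℂ) + (v : ℂ) * I)‖ ≤ C * (1 + |u|) ^ (-r))
    {v₁ : ℝ} (hv₁ : v₀ ≤ v₁) {z : ℂ} (hz : v₀ < z.im) :
    Integrable (fun x : ℝ => invFourierLine Φ v₁ x * Complex.exp (I * z * x)) ∧
      ∫ x : ℝ, invFourierLine Φ v₁ x * Complex.exp (I * z * x) = Φ z := by
  set a : ℝ := z.re with ha
  set b : ℝ := z.im with hb
  have hzab : (a : ℂ) + (b : ℂ) * I = z := Complex.re_add_im z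
  have hvb : v₀ ≤ b := hz.le
  -- the symbol on the line `Im = b`
  set φ : ℝ → ℂ := fun u => Φ ((u : ℂ) + (b : ℂ) * I) with hφ
  have hφc : Continuous φ := continuous_line_of_differentiableOn hd hvb
  have hφi : Integrable φ := integrable_line_of_decay hr hd hC hvb
  -- the kernel on the line `b` (= on the reference line `v₁`)
  set Kc : ℝ → ℂ := fun x => invFourierLine Φ b x with hKc
  have hKc_eq : ∀ x : ℝ, invFourierLine Φ v₁ x = Kc x := fun x =>
    invFourierLine_eq_of_decay hr hd hC hv₁ hvb x
  have hdagger : ∀ x : ℝ, Kc x = (1 : ℂ) / (2 * (Real.pi : ℂ)) *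
      (Complex.exp ((b * x : ℝ) : ℂ) * 𝓕 φ (x / (2 * π))) := fun x => invFourierLine_eq_fourier' _ b x
  have hK0 : ∀ x : ℝ, x < 0 → Kc x = 0 := fun x hx => invFourierLine_eq_zero_of_decay hr hd hC hvb hx
  -- growth from an intermediate line `v₀ ≤ b' < b`
  set b' : ℝ := (v₀ + b) / 2 with hb'
  have hb'₁ : v₀ ≤ b' := by rw [hb']; linarith
  have hb'₂ : b' < b := by rw [hb']; linarith
  obtain ⟨D, hD0, hD⟩ := norm_invFourierLine_le_of_decay hr hC
  have hKc_bound : ∀ x : ℝ, ‖Kc x‖ ≤ D * Real.exp (b' * x) := fun x => by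
    rw [show Kc x = invFourierLine Φ b' x from invFourierLine_eq_of_decay hr hd hC hvb hb'₁ x]
    exact hD b' hb'₁ x
  -- continuity of `Kc` (dominated convergence; no sign condition on `b` is needed here)
  have hKc_cont : Continuous Kc := by
    have hcont : Continuous (fun x : ℝ => ∫ u : ℝ, φ u * Complex.exp (-I * ((u : ℂ) + (b : ℂ) * I) * (x : ℂ))) := by
      refine continuous_iff_continuousAt.2 fun x₀ => ?_
      refine continuousAt_of_dominated
        (bound := fun u => ‖φ u‖ * Real.exp (|b| * (|x₀| + 1))) ?_ ?_ ?_ ?_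
      · exact Eventually.of_forall fun x => (integrable_lineIntegrand_of_decay hr hd hC hvb x).aestronglyMeasurable
      · have hnhds : Set.Ioo (x₀ - 1) (x₀ + 1) ∈ nhds x₀ := Ioo_mem_nhds (by linarith) (by linarith)
        filter_upwards [hnhds] with x hx
        refine Eventually.of_forall fun u => ?_
        rw [norm_mul, norm_cexp_neg_I_line']
        refine mul_le_mul_of_nonneg_left (Real.exp_le_exp.2 ?_) (norm_nonneg _)
        have hx' : |x| ≤ |x₀| + 1 := by
          rw [abs_le]; constructor <;> cases abs_cases x₀ <;> linarith [hx.1, hx.2]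
        calc b * x ≤ |b * x| := le_abs_self _
          _ = |b| * |x| := abs_mul _ _
          _ ≤ |b| * (|x₀| + 1) := mul_le_mul_of_nonneg_left hx' (abs_nonneg _)
      · exact hφi.norm.mul_const _
      · refine Eventually.of_forall fun u => ?_
        exact (continuous_const.mul (Complex.continuous_exp.comp
          (continuous_const.mul Complex.continuous_ofReal))).continuousAt
    simp only [hKc, invFourierLine]
    exact continuous_const.mul hcont
  -- the target integrand
  set G : ℝ → ℂ := fun x => Kc x * Complex.exp (I * z * x) with hG
  have hG_cont : Continuous G := hKc_cont.mul (by fun_prop)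
  have hG_norm : ∀ x : ℝ, ‖G x‖ = ‖Kc x‖ * Real.exp (-(b * x)) := fun x => by
    rw [hG]; simp only [norm_mul, norm_cexp_I_mul_mul_ofReal', hb]
  have hG_int : Integrable G := by
    have hmaj : Integrable (Set.indicator (Ici (0 : ℝ)) fun x : ℝ => D * Real.exp (-(b - b') * x)) := by
      refine IntegrableOn.integrable_indicator ?_ measurableSet_Ici
      rw [integrableOn_Ici_iff_integrableOn_Ioi]
      exact (exp_neg_integrableOn_Ioi 0 (by linarith : 0 < b - b')).const_mul D
    refine hmaj.mono' hG_cont.aestronglyMeasurable (Eventually.of_forall fun x => ?_)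
    rcases lt_or_ge x 0 with hx | hx
    · have : G x = 0 := by rw [hG]; simp [hK0 x hx]
      rw [this, norm_zero, Set.indicator_of_notMem (by simpa using hx)]
    · rw [Set.indicator_of_mem (by simpa using hx), hG_norm]
      calc ‖Kc x‖ * Real.exp (-(b * x)) ≤ D * Real.exp (b' * x) * Real.exp (-(b * x)) :=
            mul_le_mul_of_nonneg_right (hKc_bound x) (Real.exp_pos _).le
        _ = D * Real.exp (-(b - b') * x) := by rw [mul_assoc, ← Real.exp_add]; ring_nf
  -- `𝓕 φ` in terms of `G`
  have hπC : (Real.pi : ℂ) ≠ 0 := by exact_mod_cast Real.pi_ne_zero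
  have hF_eq : ∀ w : ℝ, 𝓕 φ w = (2 * (Real.pi : ℂ)) * Complex.exp (↑(-2 * π * a * w) * I) * G (2 * π * w) := by
    intro w
    have h1 := hdagger (2 * π * w)
    have hw : 2 * π * w / (2 * π) = w := by field_simp
    rw [hw] at h1
    have h2 : 𝓕 φ w = (2 * (Real.pi : ℂ)) * Complex.exp (-(((b * (2 * π * w) : ℝ)) : ℂ)) * Kc (2 * π * w) := by
      rw [h1, Complex.exp_neg]
      field_simp
    have key : Complex.exp (-(((b * (2 * π * w) : ℝ)) : ℂ)) =
        Complex.exp (↑(-2 * π * a * w) * I) * Complex.exp (I * z * ↑(2 * π * w)) := by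
      rw [← Complex.exp_add]
      congr 1
      rw [← hzab]
      push_cast
      linear_combination (-(2 : ℂ) * (π : ℂ) * (b : ℂ) * (w : ℂ)) * I_mul_I
    rw [h2, hG, key]
    simp only
    ring
  have hF_int : Integrable (𝓕 φ) := by
    have hGs : Integrable fun w : ℝ => G (2 * π * w) := hG_int.comp_mul_left' (by positivity)
    have h := hGs.bdd_mul (f := fun w : ℝ => (2 * (Real.pi : ℂ)) * Complex.exp (↑(-2 * π * a * w) * I))
      (c := 2 * π) (by fun_prop) (Eventually.of_forall fun w => by
        rw [norm_mul, Complex.norm_exp_ofReal_mul_I, mul_one]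
        simp [abs_of_pos Real.pi_pos])
    exact h.congr (Eventually.of_forall fun w => (hF_eq w).symm)
  -- Fourier inversion at the point `a`
  have hinv := congrFun (hφc.fourierInv_fourier_eq hφi hF_int) a
  rw [fourierInv_real_eq_integral_exp_smul''] at hinv
  have hint_eq : ∫ v : ℝ, Complex.exp (↑(2 * π * v * a) * I) • 𝓕 φ v =
      ∫ v : ℝ, (2 * (Real.pi : ℂ)) * G (2 * π * v) := by
    congr 1; funext v
    rw [smul_eq_mul, hF_eq v]
    have key2 : Complex.exp (↑(2 * π * v * a) * I) * Complex.exp (↑(-2 * π * a * v) * I) = 1 := by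
      rw [← Complex.exp_add, ← Complex.exp_zero]
      congr 1
      push_cast
      ring
    calc Complex.exp (↑(2 * π * v * a) * I) * ((2 * (Real.pi : ℂ)) * Complex.exp (↑(-2 * π * a * v) * I) *
          G (2 * π * v))
        = (2 * (Real.pi : ℂ)) * (Complex.exp (↑(2 * π * v * a) * I) * Complex.exp (↑(-2 * π * a * v) * I)) *
          G (2 * π * v) := by ring
      _ = (2 * (Real.pi : ℂ)) * G (2 * π * v) := by rw [key2, mul_one]
  rw [hint_eq, integral_const_mul, MeasureTheory.Measure.integral_comp_mul_left (fun x => G x)] at hinv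
  have hπabs : |(2 * π)⁻¹| = (2 * π)⁻¹ := abs_of_pos (by positivity)
  rw [hπabs] at hinv
  have hGint : ∫ x : ℝ, G x = Φ z := by
    rw [← hzab]
    change _ = φ a
    rw [← hinv, Complex.real_smul]
    push_cast
    field_simp
  refine ⟨hG_int.congr (Eventually.of_forall fun x => by rw [hG]; simp only [hKc_eq x]), ?_⟩
  rw [← hGint, hG]
  congr 1; funext x; rw [hKc_eq x]

end Generic

/-! ## §4 The kernels `K_ζ^{ω,ν}` and `G_ζ^{ω,ν}`: Prop. 4.1 (1), (4), (5) and the Fourier formula (4.9) -/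

/-- `Θ = (ξ(½−ω−iz)/ξ(½+ω−iz))^ν` is holomorphic on `Im z ≥ ½ − ω` (the denominator has
`Re(½+ω−iz) ≥ 1`, where `ξ ≠ 0`). [cite: Suzuki2021Hamiltonians, §2 (2.5)] -/
theorem differentiableOn_suzukiTheta (ω : ℝ) (ν : ℕ) :
    DifferentiableOn ℂ (suzukiTheta ω ν) {z : ℂ | 1 / 2 - ω ≤ z.im} := by
  intro z hz
  have hT : riemannXi (1 / 2 + ω - I * z) ≠ 0 := riemannXi_ne_zero_of_one_le_re (by
    simp only [mem_setOf_eq] at hz; simp; linarith)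
  have h1 : DifferentiableAt ℂ (fun w : ℂ => (1 : ℂ) / 2 - ω - I * w) z := by fun_prop
  have h2 : DifferentiableAt ℂ (fun w : ℂ => (1 : ℂ) / 2 + ω - I * w) z := by fun_prop
  unfold suzukiTheta
  exact ((((differentiable_riemannXi _).comp z h1).div ((differentiable_riemannXi _).comp z h2)
    hT).pow ν).differentiableWithinAt

/-- `Θ_∞ = (γ(½−ω−iz)/γ(½+ω−iz))^ν` is holomorphic on `Im z ≥ ½ + ω` when `ω > 0`
(`Re(½∓ω−iz) > 0`, and `γ(½+ω−iz) ≠ 0` since `Re > 1`). [cite: Suzuki2021Hamiltonians, §4.1 (4.10)] -/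
theorem differentiableOn_suzukiThetaArch {ω : ℝ} (hω : 0 < ω) (ν : ℕ) :
    DifferentiableOn ℂ (suzukiThetaArch ω ν) {z : ℂ | 1 / 2 + ω ≤ z.im} := by
  intro z hz
  simp only [mem_setOf_eq] at hz
  have hS : DifferentiableAt ℂ xiGammaFactor (1 / 2 - ω - I * z) :=
    differentiableAt_xiGammaFactor (Or.inl (by simp; linarith))
  have hT : DifferentiableAt ℂ xiGammaFactor (1 / 2 + ω - I * z) :=
    differentiableAt_xiGammaFactor (Or.inl (by simp; linarith))
  have hT0 : xiGammaFactor (1 / 2 + ω - I * z) ≠ 0 :=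
    xiGammaFactor_ne_zero_of_one_lt_re (by simp; linarith)
  have h1 : DifferentiableAt ℂ (fun w : ℂ => (1 : ℂ) / 2 - ω - I * w) z := by fun_prop
  have h2 : DifferentiableAt ℂ (fun w : ℂ => (1 : ℂ) / 2 + ω - I * w) z := by fun_prop
  have hS' : DifferentiableAt ℂ (fun w : ℂ => xiGammaFactor (1 / 2 - ω - I * w)) z :=
    DifferentiableAt.comp (g := xiGammaFactor) (f := fun w : ℂ => (1 : ℂ) / 2 - ω - I * w) z hS h1
  have hT' : DifferentiableAt ℂ (fun w : ℂ => xiGammaFactor (1 / 2 + ω - I * w)) z :=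
    DifferentiableAt.comp (g := xiGammaFactor) (f := fun w : ℂ => (1 : ℂ) / 2 + ω - I * w) z hT h2
  unfold suzukiThetaArch
  exact ((hS'.div hT' hT0).pow ν).differentiableWithinAt

/-- **[Su21] Prop. 4.1 (1), PROVED for the spectral kernels** (RH-free): for `ω > 0`, `ν ≥ 1`, `νω > 1`,
`K_ζ^{ω,ν}` (`suzukiKernel`) and `G_ζ^{ω,ν}` (`suzukiArchKernel`) vanish on `(−∞, 0)` — the first clause of
the named fact `Suzuki2021_prop41`. (Printed for the series-defined kernel, where it is «trivial by
definition»; for the spectral kernel (2.6) it is the Paley–Wiener vanishing of §3.)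
[cite: Suzuki2021Hamiltonians, Prop. 4.1 (1)] -/
theorem suzuki2021_prop41_i {ω : ℝ} (hω : 0 < ω) {ν : ℕ} (_hν : 1 ≤ ν) (hνω : 1 < (ν : ℝ) * ω) {x : ℝ}
    (hx : x < 0) : suzukiKernel ω ν x = 0 ∧ suzukiArchKernel ω ν x = 0 := by
  have hv₀ : 1 / 2 + ω < 1 + ω := by linarith
  obtain ⟨C, _, hC⟩ := norm_suzukiTheta_line_le hω ν hv₀
  obtain ⟨C', _, hC'⟩ := norm_suzukiThetaArch_line_le hω ν hv₀.le
  constructor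
  · show (invFourierLine (suzukiTheta ω ν) (1 + ω) x).re = 0
    rw [invFourierLine_eq_zero_of_decay hνω ((differentiableOn_suzukiTheta ω ν).mono fun z hz => by
      simp only [mem_setOf_eq] at hz ⊢; linarith) hC le_rfl hx, Complex.zero_re]
  · show (invFourierLine (suzukiThetaArch ω ν) (1 + ω) x).re = 0
    rw [invFourierLine_eq_zero_of_decay hνω ((differentiableOn_suzukiThetaArch hω ν).mono fun z hz => by
      simp only [mem_setOf_eq] at hz ⊢; linarith) hC' le_rfl hx, Complex.zero_re]

/-- The first clause of `Suzuki2021_prop41`, in its printed binder shape. [cite: Suzuki2021Hamiltonians, Prop. 4.1 (1)] -/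
theorem suzuki2021_prop41_i' : ∀ ω : ℝ, 0 < ω → ∀ ν : ℕ, 1 ≤ ν → 1 < (ν : ℝ) * ω →
    ∀ x : ℝ, x < 0 → suzukiKernel ω ν x = 0 ∧ suzukiArchKernel ω ν x = 0 :=
  fun _ hω _ hν hνω _ hx => suzuki2021_prop41_i hω hν hνω hx

/-- **Absolute convergence of (2.6) under (2.8)** (RH-free): for `ω > 0`, `νω > 1` and `v > ½ + ω`,
`u ↦ Θ(u + iv)` is integrable (the `rh-dbr` column's `SpectralIntegrable ω ν` at `v = 1 + ω`).
[cite: Suzuki2021Hamiltonians, §2 (2.6) with (2.8)] -/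
theorem integrable_suzukiTheta_line {ω : ℝ} (hω : 0 < ω) (ν : ℕ) (hνω : 1 < (ν : ℝ) * ω) {v : ℝ}
    (hv : 1 / 2 + ω < v) : Integrable fun u : ℝ => suzukiTheta ω ν ((u : ℂ) + (v : ℂ) * I) := by
  obtain ⟨C, _, hC⟩ := norm_suzukiTheta_line_le hω ν hv
  exact integrable_line_of_decay hνω ((differentiableOn_suzukiTheta ω ν).mono fun z hz => by
      simp only [mem_setOf_eq] at hz ⊢; linarith) hC le_rfl

/-- **[Su21] Prop. 4.1 (4), PROVED for the spectral kernel** (RH-free): under (2.8), `K_ζ^{ω,ν}` is continuous.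
[cite: Suzuki2021Hamiltonians, Prop. 4.1 (4)] -/
theorem suzuki2021_prop41_iv {ω : ℝ} (hω : 0 < ω) (ν : ℕ) (hνω : 1 < (ν : ℝ) * ω) :
    Continuous (suzukiKernel ω ν) := by
  have hv₀ : 1 / 2 + ω < 1 + ω := by linarith
  obtain ⟨C, _, hC⟩ := norm_suzukiTheta_line_le hω ν hv₀
  have h := continuous_invFourierLine_of_decay hνω ((differentiableOn_suzukiTheta ω ν).mono
    fun z hz => by simp only [mem_setOf_eq] at hz ⊢; linarith) hC le_rfl (by linarith)
  exact Complex.continuous_re.comp h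

/-- **[Su21] Prop. 4.1 (5), PROVED for the spectral kernel, with the exponent made explicit** (RH-free):
under (2.8), for every `v > ½ + ω` there is `D ≥ 0` with `|K_ζ^{ω,ν}(x)| ≤ D e^{vx}` for all real `x`
(printed: `≪ exp(c|x|)` for some `c > 0`). [cite: Suzuki2021Hamiltonians, Prop. 4.1 (5)] -/
theorem suzuki2021_prop41_v {ω : ℝ} (hω : 0 < ω) (ν : ℕ) (hνω : 1 < (ν : ℝ) * ω) {v : ℝ}
    (hv : 1 / 2 + ω < v) : ∃ D : ℝ, 0 ≤ D ∧ ∀ x : ℝ, |suzukiKernel ω ν x| ≤ D * Real.exp (v * x) := by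
  set v₀ : ℝ := min v (1 + ω) with hv₀def
  have hv₀ : 1 / 2 + ω < v₀ := lt_min hv (by linarith)
  obtain ⟨C, _, hC⟩ := norm_suzukiTheta_line_le hω ν hv₀
  have hd := (differentiableOn_suzukiTheta ω ν).mono fun z (hz : v₀ ≤ z.im) => by
    simp only [mem_setOf_eq]; linarith
  obtain ⟨D, hD0, hD⟩ := norm_invFourierLine_le_of_decay (Φ := suzukiTheta ω ν) hνω hC
  refine ⟨D, hD0, fun x => ?_⟩
  calc |suzukiKernel ω ν x| = |(invFourierLine (suzukiTheta ω ν) (1 + ω) x).re| := rfl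
    _ ≤ ‖invFourierLine (suzukiTheta ω ν) (1 + ω) x‖ := Complex.abs_re_le_norm _
    _ = ‖invFourierLine (suzukiTheta ω ν) v x‖ := by
        rw [invFourierLine_eq_of_decay hνω hd hC (min_le_right _ _) (min_le_left _ _)]
    _ ≤ D * Real.exp (v * x) := hD v (min_le_left _ _) x

/-- `conj Θ(u + iv) = Θ(−u + iv)` (Schwarz reflection for `ξ`). [cite: Titchmarsh1986, §2.1] -/
theorem conj_suzukiTheta_line (ω : ℝ) (ν : ℕ) (u v : ℝ) :
    conj (suzukiTheta ω ν ((u : ℂ) + (v : ℂ) * I)) = suzukiTheta ω ν (((-u : ℝ) : ℂ) + (v : ℂ) * I) := by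
  have hS : conj ((1 : ℂ) / 2 - (ω : ℂ) - I * ((u : ℂ) + (v : ℂ) * I)) =
      (1 : ℂ) / 2 - (ω : ℂ) - I * (((-u : ℝ) : ℂ) + (v : ℂ) * I) := by
    apply Complex.ext <;> simp
  have hT : conj ((1 : ℂ) / 2 + (ω : ℂ) - I * ((u : ℂ) + (v : ℂ) * I)) =
      (1 : ℂ) / 2 + (ω : ℂ) - I * (((-u : ℝ) : ℂ) + (v : ℂ) * I) := by
    apply Complex.ext <;> simp
  unfold suzukiTheta
  rw [map_pow, map_div₀, ← riemannXi_conj_holds, ← riemannXi_conj_holds, hS, hT]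

/-- Reality of the line integral (2.6): `conj (invFourierLine Θ v x) = invFourierLine Θ v x`.
[cite: Suzuki2021Hamiltonians, §2 (2.6)] -/
theorem conj_invFourierLine_suzukiTheta (ω : ℝ) (ν : ℕ) (v x : ℝ) :
    conj (invFourierLine (suzukiTheta ω ν) v x) = invFourierLine (suzukiTheta ω ν) v x := by
  unfold invFourierLine
  rw [map_mul]
  congr 1
  · rw [map_div₀, map_one, map_mul, Complex.conj_ofReal, map_ofNat]
  · rw [← integral_conj]
    have hint : ∀ u : ℝ, conj (suzukiTheta ω ν ((u : ℂ) + (v : ℂ) * I) *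
        Complex.exp (-I * ((u : ℂ) + (v : ℂ) * I) * (x : ℂ))) =
        suzukiTheta ω ν (((-u : ℝ) : ℂ) + (v : ℂ) * I) *
          Complex.exp (-I * (((-u : ℝ) : ℂ) + (v : ℂ) * I) * (x : ℂ)) := by
      intro u
      rw [map_mul, conj_suzukiTheta_line, ← Complex.exp_conj]
      congr 2
      simp only [map_mul, map_neg, Complex.conj_I, map_add, Complex.conj_ofReal, neg_neg]
      push_cast
      ring
    simp_rw [hint]
    have h := (integral_neg_eq_self (μ := (volume : Measure ℝ))
      (fun u : ℝ => suzukiTheta ω ν ((u : ℂ) + (v : ℂ) * I) * Complex.exp (-I * ((u : ℂ) + (v : ℂ) * I) * (x : ℂ))))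
    simpa using h

/-- `(K_ζ^{ω,ν}(x) : ℂ) = invFourierLine Θ (1+ω) x` (the real part in the definition of `suzukiKernel` is
the whole integral). [cite: Suzuki2021Hamiltonians, §2 (2.6)] -/
theorem ofReal_suzukiKernel (ω : ℝ) (ν : ℕ) (x : ℝ) :
    (suzukiKernel ω ν x : ℂ) = invFourierLine (suzukiTheta ω ν) (1 + ω) x := by
  have him : (invFourierLine (suzukiTheta ω ν) (1 + ω) x).im = 0 := by
    have h := congrArg Complex.im (conj_invFourierLine_suzukiTheta ω ν (1 + ω) x)
    simp only [Complex.conj_im] at h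
    linarith
  apply Complex.ext
  · simp [suzukiKernel]
  · simpa [suzukiKernel] using him.symm

/-- **(4.9) for the spectral kernel, PROVED** (RH-free): for `ω > 0`, `ν ≥ 1`, `νω > 1` and
`Im z > ½ + ω`, `x ↦ K_ζ^{ω,ν}(x) e^{izx}` is integrable on `ℝ` and `∫ K_ζ^{ω,ν}(x) e^{izx} dx = Θ(z)`.
[cite: Suzuki2021Hamiltonians, Prop. 4.1 (3), eq. (4.9)] -/
theorem suzuki2021_prop41_fourier {ω : ℝ} (hω : 0 < ω) {ν : ℕ} (_hν : 1 ≤ ν) (hνω : 1 < (ν : ℝ) * ω)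
    {z : ℂ} (hz : 1 / 2 + ω < z.im) :
    Integrable (fun x : ℝ => (suzukiKernel ω ν x : ℂ) * Complex.exp (I * z * x)) ∧
      ∫ x : ℝ, (suzukiKernel ω ν x : ℂ) * Complex.exp (I * z * x) = suzukiTheta ω ν z := by
  -- a decay threshold `v₀` strictly between `½ + ω` and `min (1 + ω) (Im z)`
  set v₀ : ℝ := (1 / 2 + ω + min (1 + ω) z.im) / 2 with hv₀def
  have hmin : 1 / 2 + ω < min (1 + ω) z.im := lt_min (by linarith) hz
  have hv₀ : 1 / 2 + ω < v₀ := by rw [hv₀def]; linarith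
  have hv₀1 : v₀ ≤ 1 + ω := by
    have := min_le_left (1 + ω) z.im; rw [hv₀def]; linarith
  have hv₀z : v₀ < z.im := by
    have := min_le_right (1 + ω) z.im; rw [hv₀def]; linarith
  obtain ⟨C, _, hC⟩ := norm_suzukiTheta_line_le hω ν hv₀
  have hd := (differentiableOn_suzukiTheta ω ν).mono fun w (hw : v₀ ≤ w.im) => by
    simp only [mem_setOf_eq]; linarith
  have h := integral_invFourierLine_mul_cexp_of_decay hνω hd hC hv₀1 hv₀z
  simp_rw [ofReal_suzukiKernel]
  exact h

/-- **(4.9) in the `(0, ∞)` form** — the statement of the named fact `Suzuki2021_prop41_fourier` under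
Suzuki's condition (2.8) `νω > 1`, PROVED (RH-free). ERRATUM NOTE on that named fact: it is typed without
(2.8); the print states (4.9) for the SERIES-defined kernel (4.8) and all `(ω,ν)`, and identifies it with the
spectral kernel (2.6) (the tree's `suzukiKernel`, line `Im z = 1 + ω`) «by taking the Fourier inversion
formula of (4.9)», which needs the absolute convergence of (2.6), i.e. (2.8) (`νω d_L > 1`); for `νω ≤ 1`
the line integral (2.6) does not converge absolutely and `suzukiKernel` is Bochner-junk, so the hypothesis-free
fact should not be used below `νω > 1`. [cite: Suzuki2021Hamiltonians, Prop. 4.1 (3), eq. (4.9), §2 (2.6)–(2.8)] -/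
theorem suzuki2021_prop41_laplace {ω : ℝ} (hω : 0 < ω) {ν : ℕ} (hν : 1 ≤ ν) (hνω : 1 < (ν : ℝ) * ω)
    {z : ℂ} (hz : 1 / 2 + ω < z.im) :
    IntegrableOn (fun x : ℝ => (suzukiKernel ω ν x : ℂ) * Complex.exp (I * z * x)) (Ioi 0) ∧
      ∫ x in Ioi (0 : ℝ), (suzukiKernel ω ν x : ℂ) * Complex.exp (I * z * x) = suzukiTheta ω ν z := by
  obtain ⟨hint, heq⟩ := suzuki2021_prop41_fourier hω hν hνω hz
  refine ⟨hint.integrableOn, ?_⟩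
  rw [setIntegral_congr_set Ioi_ae_eq_Ici, setIntegral_eq_integral_of_forall_compl_eq_zero, heq]
  intro x hx
  have hx' : x < 0 := by simpa using hx
  simp [(suzuki2021_prop41_i hω hν hνω hx').1]

/-! ## §5 The ERRATUM made formal: below (2.8) the spectral integral (2.6) diverges, and the
hypothesis-free named fact `Suzuki2021_prop41_fourier` is false as typed (witness `ω = ν = 1`)

For `ω = ν = 1` (`νω = 1`, (2.8) fails) the symbol on the definition line `Im z = 1 + ω = 2` is the
explicit quotient `Θ(u + 2i) = ξ(S)/ξ(S+2) = 2π (S−1)/((S+1)(S+2)) · ζ(S)/ζ(S+2)`, `S = 3/2 − iu`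
(`ξ = γζ`, `Γ_ℝ(s+2) = Γ_ℝ(s)s/(2π)`), so `|Θ(u+2i)| ≥ c/(1+|u|)` with an explicit `c > 0`: the line
integral (2.6) does NOT converge absolutely, the Bochner integral defining `suzukiKernel 1 1` is `0`, and
the identity `∫₀^∞ K e^{izx} dx = Θ(z)` claimed by the hypothesis-free fact fails at `z = 3i`
(`Θ(3i) = ξ(5/2)/ξ(9/2) ≠ 0`). The correctly guarded statement (with `νω > 1`) is the THEOREM
`suzuki2021_prop41_laplace` above. -/

open LSeries in
open scoped LSeries.notation in
/-- Lower bound for the `ω = ν = 1` symbol on its definition line `Im z = 2`: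
`|Θ_ζ^{1,1}(u + 2i)| ≥ c/(1 + |u|)` for an explicit `c > 0` (`Θ = 2π(S−1)ζ(S)/((S+1)(S+2)ζ(S+2))`,
`S = 3/2 − iu`; `|ζ(S)| ≥ 1/Σ n^{−3/2}`, `|ζ(S+2)| ≤ Σ n^{−7/2}`). This is the `|u|^{−νω d_L}` order of
(4.2)/(4.3) from below, at `νω = 1`. [cite: Suzuki2021Hamiltonians, §4.1 eqs. (4.2)–(4.3)] -/
theorem norm_suzukiTheta_one_one_line_ge :
    ∃ c : ℝ, 0 < c ∧ ∀ u : ℝ, c / (1 + |u|) ≤ ‖suzukiTheta 1 1 ((u : ℂ) + ((1 + 1 : ℝ) : ℂ) * I)‖ := by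
  set M : ℝ := ∑' n : ℕ, ‖term (fun n ↦ (ArithmeticFunction.moebius n : ℂ)) ((3 / 2 : ℝ) : ℂ) n‖
    with hM
  set Z : ℝ := ∑' n : ℕ, ‖term (1 : ℕ → ℂ) ((7 / 2 : ℝ) : ℂ) n‖ with hZ
  have hM0 : 0 ≤ M := tsum_nonneg fun _ => norm_nonneg _
  have hZ0 : 0 ≤ Z := tsum_nonneg fun _ => norm_nonneg _
  refine ⟨2 * π / 35 / ((M + 1) * (Z + 1)), by positivity, fun u => ?_⟩
  set S : ℂ := (1 : ℂ) / 2 - ((1 : ℝ) : ℂ) - I * ((u : ℂ) + ((1 + 1 : ℝ) : ℂ) * I) with hSdef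
  have hSre : S.re = 3 / 2 := by rw [hSdef, re_half_sub_omega_line]; norm_num
  have hSim : S.im = -u := by rw [hSdef, im_half_sub_omega_line]
  have hT : (1 : ℂ) / 2 + ((1 : ℝ) : ℂ) - I * ((u : ℂ) + ((1 + 1 : ℝ) : ℂ) * I) = S + 2 := by
    rw [half_add_omega_eq, ← hSdef]; push_cast; ring
  -- non-vanishing of everything in sight (`Re S = 3/2`)
  have hS0 : S ≠ 0 := fun h => by
    have := congrArg Complex.re h; rw [hSre] at this; norm_num at this
  have hS1 : S ≠ 1 := fun h => by
    have := congrArg Complex.re h; rw [hSre] at this; norm_num at this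
  have hSp1 : S + 1 ≠ 0 := fun h => by
    have := congrArg Complex.re h; simp only [add_re, one_re, zero_re, hSre] at this; norm_num at this
  have hSp2 : S + 2 ≠ 0 := fun h => by
    have := congrArg Complex.re h; simp only [add_re, hSre, zero_re] at this; norm_num at this
  have hS21 : S + 2 ≠ 1 := fun h => by
    have := congrArg Complex.re h; simp only [add_re, hSre, one_re] at this; norm_num at this
  have hS2m1 : S + 2 - 1 ≠ 0 := by rw [show S + 2 - 1 = S + 1 by ring]; exact hSp1
  have hG : Gammaℝ S ≠ 0 := Gammaℝ_ne_zero_of_re_pos (by rw [hSre]; norm_num)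
  have hG2 : Gammaℝ (S + 2) ≠ 0 := Gammaℝ_ne_zero_of_re_pos (by
    simp only [add_re, hSre]; norm_num)
  have hζS : riemannZeta S ≠ 0 := riemannZeta_ne_zero_of_one_lt_re (by rw [hSre]; norm_num)
  have hζT : riemannZeta (S + 2) ≠ 0 := riemannZeta_ne_zero_of_one_lt_re (by
    simp only [add_re, hSre]; norm_num)
  have hπ : (π : ℂ) ≠ 0 := Complex.ofReal_ne_zero.2 Real.pi_ne_zero
  -- the explicit quotient `Θ(u+2i) = 2π(S−1)/((S+1)(S+2)) · ζ(S)/ζ(S+2)`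
  have hΘ : suzukiTheta 1 1 ((u : ℂ) + ((1 + 1 : ℝ) : ℂ) * I) =
      2 * π * (S - 1) / ((S + 1) * (S + 2)) * (riemannZeta S / riemannZeta (S + 2)) := by
    have hξS : riemannXi S = S * (S - 1) / 2 * Gammaℝ S * riemannZeta S := by
      rw [← xiGammaFactor_mul_riemannZeta hS1 hG, xiGammaFactor]
    have hξT : riemannXi (S + 2) =
        (S + 2) * (S + 2 - 1) / 2 * (Gammaℝ S * S / 2 / π) * riemannZeta (S + 2) := by
      rw [← xiGammaFactor_mul_riemannZeta hS21 hG2, xiGammaFactor, Gammaℝ_add_two hS0]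
    unfold suzukiTheta
    rw [pow_one, ← hSdef, hT, hξS, hξT]
    field_simp
    ring
  -- the factor bounds
  have h1 : (1 + |u|) / 4 ≤ ‖S - 1‖ := by
    have hre : (S - 1).re = 1 / 2 := by simp only [sub_re, one_re, hSre]; norm_num
    have him : (S - 1).im = -u := by simp only [sub_im, one_im, hSim, sub_zero]
    have ha : |(S - 1).re| ≤ ‖S - 1‖ := Complex.abs_re_le_norm _
    have hb : |(S - 1).im| ≤ ‖S - 1‖ := Complex.abs_im_le_norm _
    rw [hre, abs_of_pos (by norm_num : (0 : ℝ) < 1 / 2)] at ha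
    rw [him, abs_neg] at hb
    linarith
  have h2 : ‖S + 1‖ ≤ 5 / 2 * (1 + |u|) := by
    have h := Complex.norm_le_abs_re_add_abs_im (S + 1)
    have hre : (S + 1).re = 5 / 2 := by simp only [add_re, one_re, hSre]; norm_num
    have him : (S + 1).im = -u := by simp only [add_im, one_im, hSim, add_zero]
    rw [hre, him, abs_neg, abs_of_pos (by norm_num : (0 : ℝ) < 5 / 2)] at h
    nlinarith [abs_nonneg u]
  have h3 : ‖S + 2‖ ≤ 7 / 2 * (1 + |u|) := by
    have h := Complex.norm_le_abs_re_add_abs_im (S + 2)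
    have hre : (S + 2).re = 7 / 2 := by simp only [add_re, hSre]; norm_num
    have him : (S + 2).im = -u := by simp only [add_im, hSim]; norm_num
    rw [hre, him, abs_neg, abs_of_pos (by norm_num : (0 : ℝ) < 7 / 2)] at h
    nlinarith [abs_nonneg u]
  have h4 : 1 / (M + 1) ≤ ‖riemannZeta S‖ := by
    have hinv : ‖(riemannZeta S)⁻¹‖ ≤ M :=
      norm_inv_riemannZeta_le_tsum (σ₀ := 3 / 2) (by norm_num) (s := S) (by rw [hSre])
    have hpos : 0 < ‖riemannZeta S‖ := norm_pos_iff.2 hζS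
    rw [norm_inv] at hinv
    have h1M : 1 ≤ ‖riemannZeta S‖ * M := by
      have := mul_le_mul_of_nonneg_left hinv hpos.le
      rwa [mul_inv_cancel₀ hpos.ne'] at this
    rw [div_le_iff₀ (by positivity)]
    nlinarith
  have h5 : ‖riemannZeta (S + 2)‖ ≤ Z + 1 := by
    have h : ‖riemannZeta (S + 2)‖ ≤ Z :=
      norm_riemannZeta_le_tsum (σ₀ := 7 / 2) (by norm_num) (s := S + 2)
        (by simp only [add_re, hSre]; norm_num)
    linarith
  -- assemble
  have hden : 0 < ‖S + 1‖ * ‖S + 2‖ := mul_pos (norm_pos_iff.2 hSp1) (norm_pos_iff.2 hSp2)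
  have hu : 0 < 1 + |u| := by positivity
  have hA : 2 * π / 35 / (1 + |u|) ≤ 2 * π * ‖S - 1‖ / (‖S + 1‖ * ‖S + 2‖) := by
    calc 2 * π / 35 / (1 + |u|)
        = (2 * π * ((1 + |u|) / 4)) / ((5 / 2 * (1 + |u|)) * (7 / 2 * (1 + |u|))) := by
          field_simp; ring
      _ ≤ 2 * π * ‖S - 1‖ / (‖S + 1‖ * ‖S + 2‖) := by
          apply div_le_div₀ (by positivity) (by gcongr) hden
          exact mul_le_mul h2 h3 (norm_nonneg _) (by positivity)
  have hB : 1 / (M + 1) / (Z + 1) ≤ ‖riemannZeta S‖ / ‖riemannZeta (S + 2)‖ :=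
    div_le_div₀ (norm_nonneg _) h4 (norm_pos_iff.2 hζT) h5
  calc 2 * π / 35 / ((M + 1) * (Z + 1)) / (1 + |u|)
      = (2 * π / 35 / (1 + |u|)) * (1 / (M + 1) / (Z + 1)) := by field_simp
    _ ≤ (2 * π * ‖S - 1‖ / (‖S + 1‖ * ‖S + 2‖)) * (‖riemannZeta S‖ / ‖riemannZeta (S + 2)‖) :=
        mul_le_mul hA hB (by positivity) (by positivity)
    _ = ‖2 * π * (S - 1) / ((S + 1) * (S + 2)) * (riemannZeta S / riemannZeta (S + 2))‖ := by
        simp only [norm_mul, norm_div, Complex.norm_ofNat, Complex.norm_real,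
          Real.norm_of_nonneg Real.pi_pos.le]
    _ = ‖suzukiTheta 1 1 ((u : ℂ) + ((1 + 1 : ℝ) : ℂ) * I)‖ := by rw [hΘ]

/-- Consequently the line integral (2.6) for `ω = ν = 1` on `Im z = 2` does not converge absolutely:
`u ↦ Θ_ζ^{1,1}(u + 2i)` is not integrable (`c/(1+|u|)` is not). [cite: Suzuki2021Hamiltonians, §2 (2.6)–(2.8)] -/
theorem not_integrable_suzukiTheta_one_one_line :
    ¬ Integrable (fun u : ℝ => suzukiTheta 1 1 ((u : ℂ) + ((1 + 1 : ℝ) : ℂ) * I)) := by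
  intro hint
  obtain ⟨c, hc, hle⟩ := norm_suzukiTheta_one_one_line_ge
  have hmeas : AEStronglyMeasurable (fun u : ℝ => c / (1 + |u|)) volume :=
    (continuous_const.div (by fun_prop) fun u => by positivity).aestronglyMeasurable
  have h1 : Integrable (fun u : ℝ => c / (1 + |u|)) :=
    hint.norm.mono' hmeas (Filter.Eventually.of_forall fun u => by
      rw [Real.norm_of_nonneg (by positivity)]; exact hle u)
  -- on `(1, ∞)`: `(c/2) u⁻¹ ≤ c/(1+u)`, so `u⁻¹` would be integrable there
  have h2 : IntegrableOn (fun u : ℝ => c / 2 * u⁻¹) (Ioi 1) := by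
    refine (h1.integrableOn (s := Ioi 1)).mono'
      ((measurable_const.mul measurable_inv).aestronglyMeasurable) ?_
    filter_upwards [ae_restrict_mem measurableSet_Ioi] with u hu
    have hu1 : 1 < u := hu
    rw [Real.norm_of_nonneg (by positivity), abs_of_pos (by linarith),
      show c / 2 * u⁻¹ = c / (2 * u) by field_simp]
    exact div_le_div_of_nonneg_left hc.le (by linarith) (by linarith)
  have h3 : IntegrableOn (fun u : ℝ => u⁻¹) (Ioi 1) := by
    refine (h2.const_mul (2 / c)).congr (ae_of_all _ fun u => ?_)
    show 2 / c * (c / 2 * u⁻¹) = u⁻¹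
    rw [← mul_assoc, show 2 / c * (c / 2) = 1 by field_simp, one_mul]
  exact not_integrableOn_Ioi_inv h3

/-- Hence the spectral kernel `suzukiKernel 1 1` (the Bochner integral (2.6) on `Im z = 2`, which
returns `0` on a non-integrable integrand) vanishes identically: below (2.8) the tree's `suzukiKernel` is
junk, as the ERRATUM note at `suzuki2021_prop41_laplace` says. [cite: Suzuki2021Hamiltonians, §2 (2.6)–(2.8)] -/
theorem suzukiKernel_one_one_eq_zero (x : ℝ) : suzukiKernel 1 1 x = 0 := by
  have hni : ¬ Integrable (fun u : ℝ => suzukiTheta 1 1 ((u : ℂ) + ((1 + 1 : ℝ) : ℂ) * I) *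
      Complex.exp (-I * ((u : ℂ) + ((1 + 1 : ℝ) : ℂ) * I) * (x : ℂ))) := by
    intro h
    apply not_integrable_suzukiTheta_one_one_line
    have hg : AEStronglyMeasurable
        (fun u : ℝ => Complex.exp (I * ((u : ℂ) + ((1 + 1 : ℝ) : ℂ) * I) * (x : ℂ))) volume :=
      (by fun_prop : Continuous fun u : ℝ =>
        Complex.exp (I * ((u : ℂ) + ((1 + 1 : ℝ) : ℂ) * I) * (x : ℂ))).aestronglyMeasurable
    have hb : ∀ᵐ u : ℝ, ‖Complex.exp (I * ((u : ℂ) + ((1 + 1 : ℝ) : ℂ) * I) * (x : ℂ))‖ ≤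
        Real.exp (-(1 + 1) * x) := ae_of_all _ fun u => by
      have hw : I * ((u : ℂ) + ((1 + 1 : ℝ) : ℂ) * I) * (x : ℂ) =
          ((-(1 + 1) * x : ℝ) : ℂ) + ((u * x : ℝ) : ℂ) * I := by
        push_cast
        linear_combination ((1 + 1) * (x : ℂ)) * I_mul_I
      rw [Complex.norm_exp, hw]
      simp
    refine (h.mul_bdd hg hb).congr (ae_of_all _ fun u => ?_)
    show suzukiTheta 1 1 ((u : ℂ) + ((1 + 1 : ℝ) : ℂ) * I) *
        Complex.exp (-I * ((u : ℂ) + ((1 + 1 : ℝ) : ℂ) * I) * (x : ℂ)) *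
        Complex.exp (I * ((u : ℂ) + ((1 + 1 : ℝ) : ℂ) * I) * (x : ℂ)) =
      suzukiTheta 1 1 ((u : ℂ) + ((1 + 1 : ℝ) : ℂ) * I)
    rw [mul_assoc, ← Complex.exp_add,
      show -I * ((u : ℂ) + ((1 + 1 : ℝ) : ℂ) * I) * (x : ℂ) +
          I * ((u : ℂ) + ((1 + 1 : ℝ) : ℂ) * I) * (x : ℂ) = 0 by ring,
      Complex.exp_zero, mul_one]
  unfold suzukiKernel invFourierLine
  rw [integral_undef hni, mul_zero, Complex.zero_re]

/-- **ERRATUM, formal: the named fact `Suzuki2021_prop41_fourier` (typed WITHOUT Suzuki's condition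
(2.8) `νω > 1`) is FALSE as typed.** Witness `ω = ν = 1`, `z = 3i` (`Im z = 3 > ½ + ω`): the spectral
kernel `suzukiKernel 1 1` is identically `0` (`suzukiKernel_one_one_eq_zero`), so
`∫₀^∞ K(x)e^{izx} dx = 0`, while `Θ_ζ^{1,1}(3i) = ξ(5/2)/ξ(9/2) ≠ 0`. What the print states — (4.9) for
the SERIES-defined kernel (4.8), identified with (2.6) under absolute convergence, i.e. under (2.8) — is
the THEOREM `suzuki2021_prop41_laplace`; nobody should take `(h : Suzuki2021_prop41_fourier)`.
[cite: Suzuki2021Hamiltonians, Prop. 4.1 (3), eq. (4.9), §2 (2.6)–(2.8)] -/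
theorem Suzuki2021_prop41_fourier_false : ¬ Suzuki2021_prop41_fourier := by
  intro h
  have hz : (1 : ℝ) / 2 + 1 < (3 * I : ℂ).im := by simp; norm_num
  obtain ⟨-, heq⟩ := h 1 one_pos 1 le_rfl (3 * I) hz
  have h0 : ∫ x in Ioi (0 : ℝ), (suzukiKernel 1 1 x : ℂ) * Complex.exp (I * (3 * I) * x) = 0 := by
    simp [suzukiKernel_one_one_eq_zero]
  rw [h0] at heq
  have hnum : (1 : ℂ) / 2 - ((1 : ℝ) : ℂ) - I * (3 * I) = ((5 / 2 : ℝ) : ℂ) := by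
    push_cast
    linear_combination (-3 : ℂ) * I_mul_I
  have hden : (1 : ℂ) / 2 + ((1 : ℝ) : ℂ) - I * (3 * I) = ((9 / 2 : ℝ) : ℂ) := by
    push_cast
    linear_combination (-3 : ℂ) * I_mul_I
  have hΘ : suzukiTheta 1 1 (3 * I) ≠ 0 := by
    unfold suzukiTheta
    rw [pow_one, hnum, hden]
    exact div_ne_zero (riemannXi_ne_zero_of_one_le_re (by simp; norm_num))
      (riemannXi_ne_zero_of_one_le_re (by simp; norm_num))
  exact hΘ heq.symm

end Literature.NumberTheory.LFunctions

end
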